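import Literature.Barriers.ValiantsHypothesis.CKRST20NaturalProofsExist
import Literature.Barriers.ValiantsHypothesis.CKRST20FiniteFieldsProofs
import Literature.Barriers.ValiantsHypothesis.CKRST20HittingSetsProofs
import Literature.Barriers.ValiantsHypothesis.CKRST20ExpSumHittingSets
import Literature.Computability.AlgebraicComplexity.HittingSetsCoefficientCover
import HarnessLib

/-!
# CKRST 2020, arXiv v4 §4 — *Equations in the bounded-coefficient setting*: "hitting sets give
# equations" (Thms. 4.1, 4.3) and "equations from universal polynomials" (Thm. 4.2), PROVED

P. Chatterjee, M. Kumar, C. Ramya, R. Saptharishi, A. Tengse, *On the existence of algebraically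
natural proofs*, FOCS 2020; arXiv:2004.14147 v4 §4 (= v2 §3–§4, ECCC TR20-063 §3–§4). Typed
literature, cell val-lit (t20, NP corpus; EXTEND of `CKRST20NaturalProofsExist.lean`, whose named
facts `CKRST2020_thm_1_1` … `_1_4` are the §1 COROLLARIES of the theorems here and are all
discharged elsewhere in the tree). Bears on route `BarrierLever`, rung V4. Honest framing:
`VP ≠ VNP` is NOT proved and nothing here is progress on it; these are the paper's POSITIVE-side
constructions (equations for coefficient-restricted classes exist), formalised as printed.

## What is proved (0 named facts; every statement below is a theorem)

* `CKRST2020.exists_equation_intBox` — **v4 Thm. 4.3 ("Equations from hitting sets", `ℂ`), in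
  the generality the paper states in prose** ("the proof would also generalize in a
  straightforward manner for polynomial families in `𝒞` whose coefficients are bounded by `N(n)`.
  We state this for coefficients in `{-1,0,1}` just to avoid cumbersome notation", before Thm. 4.3):
  for a finite `ℋ ⊆ [-B,B]^n ∩ ℤ^n` and a coefficient bound `A`, a nonzero `P(z)` in the
  `N = |x^{≤ d}|` coefficient variables with `size ≤ 20(|ℋ|+1)(NA+1)(N+1)W²`,
  `deg ≤ 10(|ℋ|+1)(NA+1)W²`, `W = log₂(N A B^d) + 2`, and the EXACT vanishing locus on the box:
  for `f` of degree `≤ d` with integer coefficients of modulus `≤ A`, `P(coeff f) = 0` iff `f = 0`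
  or `f` does not vanish identically on `ℋ` (print's "Usefulness" and "A remark on the largeness"
  together). Over any field of characteristic `0`.
* `CKRST2020.thm_4_3` — Thm. 4.3 in the printed shape: for every class `𝒞` of degree-`≤ d`
  polynomials hit by `ℋ ⊆ [-B,B]^n`, an equation for `𝒞' = 𝒞 ∩ {-1,0,1}`-coefficients of size and
  degree `≤ c · B⁴ · (t+1) · N⁴` (`c = 1280`, all `n ≥ 1`; print: `B⁴ · t · N⁴` for `n` large),
  nonzero at every nonzero `{-1,0,1}`-polynomial of degree `≤ d` vanishing on `ℋ`.
* `CKRST2020.thm_4_1` — **v4 Thm. 4.1 (finite fields)** at class level, BY NAME from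
  `CKRST2020.FiniteFields.exists_equation` (`CKRST20FiniteFieldsProofs.lean`, val-lit t19): bounds
  `10 · q · N · (r t + 1)`, `r = [𝕂 : 𝔽]` (print: `10 · q · N · t · log d`, `r ≤ 2 log d`);
  `P ≢ 0` unconditionally (for `r t ≥ N` via the Fermat polynomial `z^q - z`), a non-root when `r t < N`.
* `CKRST2020.thm_4_2` — **v4 Thm. 4.2 ("Equations from universal polynomials")**: a class
  generated by a universal polynomial with `m` parameters and `y`-degree `D` has an equation for its
  `{-1,0,1}` part of size/degree `≤ c (m+1)(log₂ D + 1) N⁸` (print: "`poly(N)`"); the hitting set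
  is the tree's `CoeffCover.exists_hittingSet` (Rónyai–Babai–Ganapathy form of v4 Thm. 3.1).
* `CKRST2020.exists_signCoeff_vanishing_on`, `CKRST2020.thm_4_3_withWitness` — the print's "remark
  on the largeness" (proof of Thm. 1.6, "essentially an instance of a lemma of Siegel"): if
  `(2NB^d+1)^{|ℋ|} < 2^N`, some nonzero `{-1,0,1}`-polynomial of degree `≤ d` vanishes on `ℋ`, so the
  equation of Thm. 4.3 has a `{-1,0,1}` NON-ROOT — both bullets of Thms. 1.6/1.8 at a fixed `n`, for
  any class hit by `ℋ`.
* `CKRST2020.exists_equation_vpSlice_intBox`, `CKRST2020.exists_equation_definableSlice_intBox` —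
  the mechanisms of Thms. 1.6 / 1.8 at a fixed `n` with the coefficient bound `A` as a parameter:
  equations for `𝒞(n,d,s) ∩ [-A,A]`-coefficients (from `CKRST2020_lemma12_holds`, [HS80a]) and for
  `𝒟(n,d,s) ∩ [-A,A]`-coefficients (from `CKRST2020.exists_hittingSet_definableSlice`, v4 Lemma
  3.7), size polynomial in `N`, `s` and LINEAR in `A` — i.e. exponential in the coefficient
  bit-length, which is exactly why the printed method stops at coefficients of magnitude `poly(N)`
  (v4 §6: integer coefficients of magnitude `exp((log N)^{log* N})` "will imply `VP`-natural proofs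
  for all of `VP`"; compare the route's PROVED coefficient-axis items `SuccinctHittingSetsIffIntegerSlice`
  / `IntegerBoxVanishingTransfer`, magnitude `2^{n³}`). Nothing here moves that door.

## The construction (v4 proof of Thm. 4.3, followed step by step)

`P(z) = Λ(z) · ∏_{a ∈ ℋ} ∏_{r=2}^{K} Q_{R,r}(Σ_m z_m · (a^m mod r))`, where
`Q_{R,r}(x) = ∏_{i ∈ [-R,R], r ∤ i} (x - i)` (`IntEquations.qFactor`), the proxy evaluations
`~eval_r(a)_m = a^m mod r` (`IntEquations.wmod`), `K = 2 log₂ M + 3` moduli for `M = N·A·B^d ≥ |f(a)|`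
(`IntEquations.numModuli`; print: primes `r ≤ ℓ²`, `ℓ = log(M+1)` — every integer modulus works, by
`lcm(1..K) ≥ 2^K/(K+1)`, Mathlib `Chebyshev.two_pow_le_mul_lcmUpto`, as in
`CKRST2020_claim13_holds`), `R = N·A·K ≥ |⟨coeff f, ~eval_r(a)⟩|` (`IntEquations.proxyRange`).
Usefulness (`IntEquations.eval_equation_eq_zero_iff`): `⟨coeff f, ~eval_r(a)⟩ ≡ f(a) (mod r)`
(`dvd_sum_wmod_sub_sum_mval`); if `f(a) ≠ 0` then some `r ≤ K` has `r ∤ f(a)` (Claim 4.4,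
`exists_not_dvd_of_natAbs_le`), so the proxy is a non-multiple of `r` in `[-R, R]` and `Q_{R,r}`
kills it; conversely a vanishing factor exhibits `r ∤ proxy ≡ f(a)`, so `f(a) ≠ 0`. ONE deviation
from the printed formula: the zero-detector is `Λ(z) = Σ_m z_m²` (`IntEquations.lam`) instead of
`OR(z) = 1 - ∏_m (1 - z_m)`, because `OR` detects `z ≠ 0` only on `{-1,0,1}^N` while `Λ` does on
`ℤ^N` (needed for the general box); same size order. Sizes are the tree's fan-in-two `complexity`
(constants free), bounded gate by gate (`complexity_equation_le`; no sharing of the linear forms is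
used, whence `N²` where print has `N` — immaterial at the printed `N⁴` scale).

## Not typed here, and why

* v4 Thms. 3.1–3.3 and Lemmas 2.32–2.33 ([HS80a] rewordings: Bezout's inequality, `dim`/`deg` of
  the closure of the coefficient vectors, hitting sets of `n`-INDEPENDENT size `10 · dim W`): they
  need degree/dimension theory of affine varieties, absent from the tree (cf. the zero-dimensional
  Bezout HYPOTHESIS `hBez` of `BurgisserKrickPardoShape.lean`); the tree's PROVED substitute with an
  extra factor `n log|S|` is `CoeffCover.exists_hittingSet` / `HittingSets.exists_hittingSet`. For the
  same reason the residual named fact `CKRST2020_lemma21_affineSpace` ([HY11a] Claim 3.6 at `𝔸^k`,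
  an affine Bezout count) stays a fact. No new conjecture or fact is introduced.
* Print-reading notes (candidates for the cell's errata list, none affecting the typed statements):
  v4 Thm. 3.1 prints "`H ⊂ [10m]^n` of size at most `D·(d+1)²`" where Thm. 3.3 (its source) has
  points in `[deg 𝒬 · (d+1)²]^n` and `t = 10 · dim W ≤ 10m` points (the two parameters appear
  swapped); Thm. 4.1's bound `10 q N t log d` vanishes at `d = 1` and Thm. 4.3's `B⁴ t N⁴` at `t = 0`
  (degenerate parameters excluded by "large enough"; typed with `r t + 1`, `t + 1`).

## References

* [ChatterjeeKumarRamyaSaptharishiTengse2020] arXiv:2004.14147 v4 §4: Thm. 4.1 (TeX L1246–1253),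
  Thm. 4.2 (L1322–1327), Thm. 4.3 (L1334–1411), Claim 4.4; v2 §3–§4 (corpus paper:arxiv-2004.14147
  p0010–p0012); ECCC TR20-063 §3–§4. TeX: cell HOME/lit/src/2004.14147/main.tex.
* [HeintzSchnorr1980] (hitting sets; here via `CKRST2020_lemma12_holds`, `CoeffCover.exists_hittingSet`).
* [Burgisser2000] Def. 2.1 (the size measure `complexity`).
-/

noncomputable section

namespace Literature.Barriers.ValiantsHypothesis

open Literature.Computability.AlgebraicComplexity MvPolynomial

namespace CKRST2020

namespace IntEquations

/-! ### Chinese remaindering (v4 Claim 4.4): a nonzero integer of modulus `≤ M` has a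
non-divisor `r ∈ [2, 2 log₂ M + 3]` -/

/-- **CRT step of v4 Thm. 4.3 (Claim 4.4)**, sharpened as in `CKRST2020_claim13_holds`: if
`0 < |v| ≤ M` then some `r ∈ [2, 2(log₂ M + 1) + 1]` does not divide `v` (else
`lcm(1..K) ∣ v`, contradicting `2^K ≤ (K+1)·lcm(1..K)`, Mathlib `Chebyshev.two_pow_le_mul_lcmUpto`;
print: "some prime `r ≤ ℓ²`", `ℓ = log(M+1)`).
[cite: ChatterjeeKumarRamyaSaptharishiTengse2020, Claim 4.4 (arXiv v4)] -/
theorem exists_not_dvd_of_natAbs_le {v : ℤ} (hv : v ≠ 0) {M : ℕ} (hM : v.natAbs ≤ M) :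
    ∃ r : ℕ, 2 ≤ r ∧ r ≤ 2 * (Nat.log 2 M + 1) + 1 ∧ ¬ ((r : ℤ) ∣ v) := by
  classical
  set L : ℕ := Nat.log 2 M + 1 with hL
  set K : ℕ := 2 * L + 1 with hK
  have hML : M < 2 ^ L := Nat.lt_pow_succ_log_self one_lt_two M
  have hv1 : v.natAbs ≠ 0 := Int.natAbs_ne_zero.mpr hv
  have hex : ∃ r ∈ Finset.Icc 2 K, ¬ (r ∣ v.natAbs) := by
    by_contra hall
    push Not at hall
    have hdvd : Nat.lcmUpto K ∣ v.natAbs := by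
      refine Finset.lcm_dvd (fun b hb => ?_)
      rw [Finset.mem_Icc] at hb
      rcases Nat.eq_or_lt_of_le hb.1 with h1 | h1
      · rw [← h1]; exact one_dvd _
      · exact hall b (Finset.mem_Icc.mpr ⟨h1, hb.2⟩)
    have h1 : Nat.lcmUpto K ≤ M := (Nat.le_of_dvd (Nat.pos_of_ne_zero hv1) hdvd).trans hM
    have h2 := Chebyshev.two_pow_le_mul_lcmUpto K
    have hL2 : L + 1 ≤ 2 ^ L := Nat.lt_two_pow_self
    have h3 : (K + 1) * 2 ^ L ≤ 2 ^ K := by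
      have : 2 ^ K = 2 ^ L * 2 ^ L * 2 := by rw [hK, pow_succ, two_mul, pow_add]
      rw [this, hK]
      nlinarith
    have h4 : (K + 1) * Nat.lcmUpto K < (K + 1) * 2 ^ L :=
      Nat.mul_lt_mul_of_pos_left (h1.trans_lt hML) (Nat.succ_pos K)
    omega
  obtain ⟨r, hr, hndvd⟩ := hex
  rw [Finset.mem_Icc] at hr
  exact ⟨r, hr.1, hr.2, fun h => hndvd (Int.natCast_dvd.mp h)⟩

/-! ### The gadgets of the construction, over a field `K` of characteristic zero, in coefficient
variables indexed by a finite type `ι` (later `ι = x^{≤ d}`): the integer linear form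
`ℓ_w(z) = Σ_i w_i z_i`, the CRT factor `Q_{R,r}(ℓ_w) = ∏_{|i| ≤ R, r ∤ i} (ℓ_w - i)` and the
zero-detector `Λ(z) = Σ_i z_i²` -/

section Gadgets

variable (K : Type*) [Field K] {ι : Type*} [Fintype ι]

/-- The linear form `ℓ_w(z) = Σ_i w_i · z_i` with integer weights (v4 Thm. 4.3: the inner products
`⟨z, ~eval_r(a)⟩`). [cite: ChatterjeeKumarRamyaSaptharishiTengse2020, Thm. 4.3 (arXiv v4), proof] -/
def linForm (w : ι → ℤ) : MvPolynomial ι K :=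
  ∑ i, C ((w i : ℤ) : K) * X i

/-- The CRT factor `Q_r(ℓ_w(z))`, `Q_r(x) = ∏_{i ∈ [-R, R], i mod r ≠ 0} (x - i)` (v4 Thm. 4.3).
[cite: ChatterjeeKumarRamyaSaptharishiTengse2020, Thm. 4.3 (arXiv v4), proof] -/
def qFactor (R r : ℕ) (w : ι → ℤ) : MvPolynomial ι K :=
  ∏ i ∈ (Finset.Icc (-(R : ℤ)) R).filter (fun i => ¬ ((r : ℤ) ∣ i)), (linForm K w - C ((i : ℤ) : K))

variable (ι) in
/-- The zero-detector `Λ(z) = Σ_i z_i²`: on INTEGER vectors it vanishes exactly at `z = 0`. (Print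
uses `OR(z) = 1 - ∏_m (1 - z_m)`, which detects `z ≠ 0` only on `{-1,0,1}^N`; `Λ` does so on all of
`ℤ^N`, at the same cost — the one deviation from the printed formula.)
[cite: ChatterjeeKumarRamyaSaptharishiTengse2020, Thm. 4.3 (arXiv v4), proof] -/
def lam : MvPolynomial ι K :=
  ∑ i, (X i : MvPolynomial ι K) ^ 2

variable {K}

/-- `ℓ_w` at an integer vector is the integer `Σ_i w_i z_i`. [cite: ChatterjeeKumarRamyaSaptharishiTengse2020, Thm. 4.3 (arXiv v4), proof] -/
theorem eval_linForm_intCast (w z : ι → ℤ) :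
    eval (fun i => ((z i : ℤ) : K)) (linForm K w) = ((∑ i, w i * z i : ℤ) : K) := by
  rw [linForm, map_sum]
  push_cast
  refine Finset.sum_congr rfl fun i _ => ?_
  rw [map_mul, eval_C, eval_X]

variable [CharZero K]

/-- **The CRT factor vanishes at an integer vector iff `|ℓ_w(z)| ≤ R` and `r ∤ ℓ_w(z)`.**
[cite: ChatterjeeKumarRamyaSaptharishiTengse2020, Thm. 4.3 (arXiv v4), proof] -/
theorem eval_qFactor_intCast_eq_zero_iff (R r : ℕ) (w z : ι → ℤ) :
    eval (fun i => ((z i : ℤ) : K)) (qFactor K R r w) = 0 ↔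
      |∑ i, w i * z i| ≤ R ∧ ¬ ((r : ℤ) ∣ ∑ i, w i * z i) := by
  classical
  rw [qFactor, map_prod, Finset.prod_eq_zero_iff]
  simp only [Finset.mem_filter, Finset.mem_Icc, map_sub, eval_C, eval_linForm_intCast, sub_eq_zero,
    Int.cast_inj]
  constructor
  · rintro ⟨i, ⟨⟨h1, h2⟩, h3⟩, h4⟩
    rw [h4]
    exact ⟨abs_le.mpr ⟨h1, h2⟩, h3⟩
  · rintro ⟨h1, h2⟩
    exact ⟨_, ⟨⟨(abs_le.mp h1).1, (abs_le.mp h1).2⟩, h2⟩, rfl⟩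

omit [CharZero K] in
/-- `Λ` at an integer vector is `Σ_i z_i²`. [cite: ChatterjeeKumarRamyaSaptharishiTengse2020, Thm. 4.3 (arXiv v4), proof] -/
theorem eval_lam_intCast (z : ι → ℤ) :
    eval (fun i => ((z i : ℤ) : K)) (lam K ι) = ((∑ i, z i ^ 2 : ℤ) : K) := by
  rw [lam, map_sum]
  push_cast
  refine Finset.sum_congr rfl fun i _ => ?_
  rw [map_pow, eval_X]

/-- **`Λ(z) = 0` iff `z = 0`, for integer `z`.** [cite: ChatterjeeKumarRamyaSaptharishiTengse2020, Thm. 4.3 (arXiv v4), proof] -/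
theorem eval_lam_intCast_eq_zero_iff (z : ι → ℤ) :
    eval (fun i => ((z i : ℤ) : K)) (lam K ι) = 0 ↔ z = 0 := by
  rw [eval_lam_intCast, Int.cast_eq_zero,
    Finset.sum_eq_zero_iff_of_nonneg (fun i _ => sq_nonneg (z i))]
  simp [funext_iff]

/-- Each CRT factor is a nonzero polynomial (its value at `z = 0` is `∏ (-i) ≠ 0`, as `r ∤ i`
forces `i ≠ 0`). [cite: ChatterjeeKumarRamyaSaptharishiTengse2020, Thm. 4.3 (arXiv v4), proof] -/
theorem qFactor_ne_zero (R r : ℕ) (w : ι → ℤ) : qFactor K R r w ≠ 0 := by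
  classical
  rw [qFactor]
  refine Finset.prod_ne_zero_iff.mpr fun i hi h => ?_
  rw [Finset.mem_filter] at hi
  have h0 : i ≠ 0 := by rintro rfl; exact hi.2 (dvd_zero _)
  have := congrArg (eval (fun j => ((0 : ℤ) : K))) h
  rw [map_sub, eval_C, map_zero, eval_linForm_intCast, sub_eq_zero] at this
  simp only [mul_zero, Finset.sum_const_zero, Int.cast_zero] at this
  exact h0 (by exact_mod_cast this.symm)

/-- `Λ ≠ 0` as soon as there is a coefficient variable. [cite: ChatterjeeKumarRamyaSaptharishiTengse2020, Thm. 4.3 (arXiv v4), proof] -/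
theorem lam_ne_zero [Nonempty ι] : lam K ι ≠ 0 := by
  classical
  obtain ⟨i₀⟩ := ‹Nonempty ι›
  intro h
  have := congrArg (eval (fun j => (((Pi.single i₀ (1 : ℤ) : ι → ℤ) j : ℤ) : K))) h
  rw [map_zero, eval_lam_intCast_eq_zero_iff] at this
  have h1 : (1 : ℤ) = 0 := by simpa using congrFun this i₀
  exact one_ne_zero h1

/-! #### Degree bookkeeping -/

omit [CharZero K] in
/-- `deg ℓ_w ≤ 1`. [cite: ChatterjeeKumarRamyaSaptharishiTengse2020, Thm. 4.3 (arXiv v4), proof] -/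
theorem totalDegree_linForm_le (w : ι → ℤ) : (linForm K w).totalDegree ≤ 1 := by
  classical
  refine (totalDegree_finsetSum _ _).trans (Finset.sup_le fun i _ => ?_)
  refine (totalDegree_mul _ _).trans ?_
  rw [totalDegree_C, totalDegree_X, zero_add]

omit [CharZero K] in
/-- `deg Q_{R,r}(ℓ_w) ≤ 2R + 1`. [cite: ChatterjeeKumarRamyaSaptharishiTengse2020, Thm. 4.3 (arXiv v4), "Constructibility"] -/
theorem totalDegree_qFactor_le (R r : ℕ) (w : ι → ℤ) :
    (qFactor K R r w).totalDegree ≤ 2 * R + 1 := by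
  classical
  rw [qFactor]
  refine (totalDegree_finsetProd _ _).trans ?_
  calc ∑ i ∈ (Finset.Icc (-(R : ℤ)) R).filter (fun i => ¬ ((r : ℤ) ∣ i)),
        (linForm K w - C ((i : ℤ) : K)).totalDegree
      ≤ ∑ _i ∈ (Finset.Icc (-(R : ℤ)) R).filter (fun i => ¬ ((r : ℤ) ∣ i)), 1 := by
        refine Finset.sum_le_sum fun i _ => ?_
        refine (totalDegree_sub _ _).trans (max_le (totalDegree_linForm_le w) ?_)
        rw [totalDegree_C]; exact zero_le_one
    _ ≤ (Finset.Icc (-(R : ℤ)) R).card := by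
        rw [Finset.sum_const, smul_eq_mul, mul_one]
        exact Finset.card_filter_le _ _
    _ = 2 * R + 1 := by
        rw [Int.card_Icc]; omega

omit [CharZero K] in
/-- `deg Λ ≤ 2`. [cite: ChatterjeeKumarRamyaSaptharishiTengse2020, Thm. 4.3 (arXiv v4), proof] -/
theorem totalDegree_lam_le : (lam K ι).totalDegree ≤ 2 := by
  classical
  refine (totalDegree_finsetSum _ _).trans (Finset.sup_le fun i _ => ?_)
  refine (totalDegree_pow _ _).trans ?_
  rw [totalDegree_X, mul_one]

/-! #### Size bookkeeping (`complexity` = fan-in-two circuit size, constants free) -/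

omit [CharZero K] in
/-- `L(ℓ_w) ≤ 2N`. [cite: Burgisser2000, §2.1] -/
theorem complexity_linForm_le (w : ι → ℤ) : complexity (linForm K w) ≤ 2 * Fintype.card ι := by
  classical
  rw [linForm]
  refine (complexity_finset_sum_le _ _).trans ?_
  calc ∑ i, complexity (C ((w i : ℤ) : K) * X i : MvPolynomial ι K) + Finset.univ.card
      ≤ ∑ _i : ι, 1 + Finset.univ.card := by
        refine Nat.add_le_add_right (Finset.sum_le_sum fun i _ => ?_) _
        calc complexity (C ((w i : ℤ) : K) * X i : MvPolynomial ι K)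
            ≤ complexity (C ((w i : ℤ) : K) : MvPolynomial ι K) + complexity (X i : MvPolynomial ι K) + 1 :=
              complexity_mul_le_holds _ _
          _ = 1 := by rw [complexity_C_holds, complexity_X_holds]
    _ = 2 * Fintype.card ι := by rw [Finset.sum_const, smul_eq_mul, mul_one, Finset.card_univ]; ring

omit [CharZero K] in
/-- `L(Q_{R,r}(ℓ_w)) ≤ (2R+1)(2N+2)` (each of the `≤ 2R+1` affine factors costs `≤ 2N + 1`, plus one
product gate). [cite: Burgisser2000, §2.1] -/
theorem complexity_qFactor_le (R r : ℕ) (w : ι → ℤ) :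
    complexity (qFactor K R r w) ≤ (2 * R + 1) * (2 * Fintype.card ι + 2) := by
  classical
  rw [qFactor]
  set S := (Finset.Icc (-(R : ℤ)) R).filter (fun i => ¬ ((r : ℤ) ∣ i)) with hS
  have hScard : S.card ≤ 2 * R + 1 := by
    refine (Finset.card_filter_le _ _).trans ?_
    rw [Int.card_Icc]; omega
  refine (complexity_finset_prod_le _ _).trans ?_
  calc ∑ i ∈ S, complexity (linForm K w - C ((i : ℤ) : K)) + S.card
      ≤ ∑ _i ∈ S, (2 * Fintype.card ι + 1) + S.card := by
        refine Nat.add_le_add_right (Finset.sum_le_sum fun i _ => ?_) _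
        rw [sub_eq_add_neg, ← map_neg C]
        calc complexity (linForm K w + C (-((i : ℤ) : K)))
            ≤ complexity (linForm K w) + complexity (C (-((i : ℤ) : K)) : MvPolynomial ι K) + 1 :=
              complexity_add_le_holds _ _
          _ ≤ 2 * Fintype.card ι + 0 + 1 := by
              rw [complexity_C_holds]
              exact Nat.add_le_add_right (Nat.add_le_add_right (complexity_linForm_le w) _) _
          _ = 2 * Fintype.card ι + 1 := by ring
    _ = S.card * (2 * Fintype.card ι + 2) := by rw [Finset.sum_const, smul_eq_mul]; ring
    _ ≤ (2 * R + 1) * (2 * Fintype.card ι + 2) := Nat.mul_le_mul_right _ hScard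

omit [CharZero K] in
/-- `L(Λ) ≤ 2N`. [cite: Burgisser2000, §2.1] -/
theorem complexity_lam_le : complexity (lam K ι) ≤ 2 * Fintype.card ι := by
  classical
  rw [lam]
  refine (complexity_finset_sum_le _ _).trans ?_
  calc ∑ i, complexity ((X i : MvPolynomial ι K) ^ 2) + Finset.univ.card
      ≤ ∑ _i : ι, 1 + Finset.univ.card := by
        refine Nat.add_le_add_right (Finset.sum_le_sum fun i _ => ?_) _
        rw [pow_two]
        calc complexity ((X i : MvPolynomial ι K) * X i)
            ≤ complexity (X i : MvPolynomial ι K) + complexity (X i : MvPolynomial ι K) + 1 :=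
              complexity_mul_le_holds _ _
          _ = 1 := by rw [complexity_X_holds]
    _ = 2 * Fintype.card ι := by rw [Finset.sum_const, smul_eq_mul, mul_one, Finset.card_univ]; ring

end Gadgets

/-! ### Integer evaluation points: monomial values `a^m`, proxies `a^m mod r`, and the equation
`P = Λ(z) · ∏_{a ∈ ℋ} ∏_{r=2}^{K} Q_{R,r}(Σ_m z_m (a^m mod r))` -/

section Points

variable {K : Type*} [Field K] {n d : ℕ}

/-- The monomial value `a^m = ∏_j a_j^{m_j} ∈ ℤ` of an integer point (v4 Thm. 4.3: the vector
`eval(a) ∈ ℚ^N`, `eval(a)_m = m(a)`). [cite: ChatterjeeKumarRamyaSaptharishiTengse2020, Thm. 4.3 (arXiv v4), proof] -/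
def mval (a : Fin n → ℤ) (μ : monomialsDegLE n d) : ℤ :=
  ∏ j, a j ^ (μ : Fin n →₀ ℕ) j

/-- The proxy evaluation `~eval_r(a)_m = (m(a) mod r) ∈ {0, …, r-1}` (v4 Thm. 4.3).
[cite: ChatterjeeKumarRamyaSaptharishiTengse2020, Thm. 4.3 (arXiv v4), proof] -/
def wmod (a : Fin n → ℤ) (r : ℕ) (μ : monomialsDegLE n d) : ℤ :=
  mval a μ % (r : ℤ)

/-- `|a^m| ≤ B^d` for `a ∈ [-B, B]^n`, `B ≥ 1`, `deg m ≤ d` (print: "`|f(a)| ≤ N · B^d`").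
[cite: ChatterjeeKumarRamyaSaptharishiTengse2020, Thm. 4.3 (arXiv v4), proof] -/
theorem abs_mval_le {B : ℕ} (hB1 : 1 ≤ B) {a : Fin n → ℤ} (ha : ∀ j, |a j| ≤ B)
    (μ : monomialsDegLE n d) : |mval a μ| ≤ (B : ℤ) ^ d := by
  have hμ : (μ : Fin n →₀ ℕ).degree ≤ d := μ.2
  rw [Finsupp.degree_eq_sum] at hμ
  rw [mval, Finset.abs_prod]
  calc ∏ j, |a j ^ (μ : Fin n →₀ ℕ) j| = ∏ j, |a j| ^ (μ : Fin n →₀ ℕ) j := by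
        simp_rw [abs_pow]
    _ ≤ ∏ j, (B : ℤ) ^ (μ : Fin n →₀ ℕ) j :=
        Finset.prod_le_prod (fun j _ => by positivity)
          (fun j _ => pow_le_pow_left₀ (abs_nonneg _) (ha j) _)
    _ = (B : ℤ) ^ (∑ j, (μ : Fin n →₀ ℕ) j) := Finset.prod_pow_eq_pow_sum _ _ _
    _ ≤ (B : ℤ) ^ d := pow_le_pow_right₀ (by exact_mod_cast hB1) hμ

/-- `0 ≤ (a^m mod r) < r` for `r ≥ 1`. [cite: ChatterjeeKumarRamyaSaptharishiTengse2020, Thm. 4.3 (arXiv v4), proof] -/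
theorem abs_wmod_le {r : ℕ} (hr : 1 ≤ r) (a : Fin n → ℤ) (μ : monomialsDegLE n d) :
    |wmod a r μ| ≤ r := by
  have hr0 : (0 : ℤ) < r := by exact_mod_cast hr
  rw [wmod, abs_le]
  exact ⟨(neg_nonpos.mpr hr0.le).trans (Int.emod_nonneg _ hr0.ne'), (Int.emod_lt_of_pos _ hr0).le⟩

/-- The proxy inner product is congruent to the true value: `r ∣ Σ_m (a^m mod r) z_m - Σ_m a^m z_m`
(v4 Claim 4.4: "`⟨coeff(f), ~eval_r(a)⟩ ≡ f(a) mod r`").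
[cite: ChatterjeeKumarRamyaSaptharishiTengse2020, Claim 4.4 (arXiv v4), proof] -/
theorem dvd_sum_wmod_sub_sum_mval [Fintype (monomialsDegLE n d)] (a : Fin n → ℤ) (r : ℕ)
    (z : monomialsDegLE n d → ℤ) :
    (r : ℤ) ∣ (∑ μ, wmod a r μ * z μ) - ∑ μ, mval a μ * z μ := by
  rw [← Finset.sum_sub_distrib]
  refine Finset.dvd_sum fun μ _ => ?_
  rw [← sub_mul]
  refine Dvd.dvd.mul_right ?_ _
  have h : (r : ℤ) ∣ mval a μ - wmod a r μ :=
    ⟨mval a μ / r, by rw [wmod, Int.emod_def]; ring⟩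
  rw [← neg_sub]
  exact (dvd_neg).mpr h

/-- `|Σ_m w_m z_m| ≤ N · W · A` when `|w_m| ≤ W`, `|z_m| ≤ A`. [folklore] -/
private theorem abs_sum_mul_le {ι : Type*} [Fintype ι] {w z : ι → ℤ} {W A : ℕ}
    (hw : ∀ i, |w i| ≤ W) (hz : ∀ i, |z i| ≤ A) :
    |∑ i, w i * z i| ≤ (Fintype.card ι * W * A : ℕ) := by
  calc |∑ i, w i * z i| ≤ ∑ i, |w i * z i| := Finset.abs_sum_le_sum_abs _ _
    _ ≤ ∑ _i : ι, ((W * A : ℕ) : ℤ) := by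
        refine Finset.sum_le_sum fun i _ => ?_
        rw [abs_mul, Nat.cast_mul]
        exact mul_le_mul (hw i) (hz i) (abs_nonneg _) (by positivity)
    _ = (Fintype.card ι * W * A : ℕ) := by
        rw [Finset.sum_const, Finset.card_univ, nsmul_eq_mul]; push_cast; ring

/-- The number of moduli `K = 2(log₂ M + 1) + 1` for `M = N · A · B^d` (v4 Thm. 4.3: `ℓ²`,
`ℓ = log(M+1)`). [cite: ChatterjeeKumarRamyaSaptharishiTengse2020, Thm. 4.3 (arXiv v4), proof] -/
def numModuli (N A B d : ℕ) : ℕ :=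
  2 * (Nat.log 2 (N * A * B ^ d) + 1) + 1

/-- The proxy range `R = N · A · K` (v4 Thm. 4.3: "`|⟨coeff(f), ~eval_r(a)⟩| ≤ N · ℓ² =: R`", here
with the coefficient bound `A`). [cite: ChatterjeeKumarRamyaSaptharishiTengse2020, Thm. 4.3 (arXiv v4), proof] -/
def proxyRange (N A B d : ℕ) : ℕ :=
  N * A * numModuli N A B d

variable (K)

/-- **The equation of v4 Thm. 4.3** for the hitting set `ℋ`, coefficient box `[-A, A]` and point
box `[-B, B]`: `P = Λ(z) · ∏_{a ∈ ℋ} ∏_{r=2}^{K} Q_{R,r}(Σ_m z_m · (a^m mod r))`.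
[cite: ChatterjeeKumarRamyaSaptharishiTengse2020, Thm. 4.3 (arXiv v4), proof] -/
def equation [Fintype (monomialsDegLE n d)] (A B : ℕ) (H : Finset (Fin n → ℤ)) :
    MvPolynomial (monomialsDegLE n d) K :=
  lam K (monomialsDegLE n d) *
    ∏ a ∈ H, ∏ r ∈ Finset.Icc 2 (numModuli (Fintype.card (monomialsDegLE n d)) A B d),
      qFactor K (proxyRange (Fintype.card (monomialsDegLE n d)) A B d) r (wmod a r)

variable {K}

/-- The equation is a nonzero polynomial. [cite: ChatterjeeKumarRamyaSaptharishiTengse2020, Thm. 4.3 (arXiv v4), proof] -/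
theorem equation_ne_zero [Fintype (monomialsDegLE n d)] [CharZero K] (A B : ℕ)
    (H : Finset (Fin n → ℤ)) : equation K A B H ≠ (0 : MvPolynomial (monomialsDegLE n d) K) := by
  classical
  haveI : Nonempty (monomialsDegLE n d) := ⟨⟨0, by change Finsupp.degree _ ≤ d; simp⟩⟩
  rw [equation]
  refine mul_ne_zero lam_ne_zero (Finset.prod_ne_zero_iff.mpr fun a _ => ?_)
  exact Finset.prod_ne_zero_iff.mpr fun r _ => qFactor_ne_zero _ _ _

/-- **Vanishing criterion of v4 Thm. 4.3 ("Usefulness" + "A remark on the largeness"), at an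
integer coefficient vector `z ∈ [-A, A]^N`:** `P(z) = 0` iff `z = 0` or `Σ_m a^m z_m ≠ 0` for some
`a ∈ ℋ` — i.e. iff the polynomial with coefficient vector `z` is zero or does not vanish on `ℋ`.
(`⇐`, nonzero value `v`, `|v| ≤ M`: some `r ≤ K` has `r ∤ v`, so `r ∤` the proxy, which has modulus
`≤ R`, so `Q_{R,r}` kills it; `⇒`: a vanishing CRT factor exhibits `r ∤` proxy `≡ v`, so `v ≠ 0`.)
[cite: ChatterjeeKumarRamyaSaptharishiTengse2020, Thm. 4.3 (arXiv v4), proof] -/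
theorem eval_equation_eq_zero_iff [Fintype (monomialsDegLE n d)] [CharZero K] {A B : ℕ}
    (hB1 : 1 ≤ B) {H : Finset (Fin n → ℤ)} (hH : ∀ a ∈ H, ∀ j, |a j| ≤ B)
    (z : monomialsDegLE n d → ℤ) (hz : ∀ μ, |z μ| ≤ A) :
    eval (fun μ => ((z μ : ℤ) : K)) (equation K A B H) = 0 ↔
      (z ≠ 0 → ∃ a ∈ H, ∑ μ, mval a μ * z μ ≠ 0) := by
  classical
  set N := Fintype.card (monomialsDegLE n d) with hN
  -- the key equivalence, one point at a time
  have key : ∀ a ∈ H,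
      (∃ r ∈ Finset.Icc 2 (numModuli N A B d),
        eval (fun μ => ((z μ : ℤ) : K)) (qFactor K (proxyRange N A B d) r (wmod a r)) = 0) ↔
      ∑ μ, mval a μ * z μ ≠ 0 := by
    intro a ha
    simp_rw [eval_qFactor_intCast_eq_zero_iff, Finset.mem_Icc]
    constructor
    · rintro ⟨r, -, -, hndvd⟩ h0
      apply hndvd
      have hd := dvd_sum_wmod_sub_sum_mval a r z
      rwa [h0, sub_zero] at hd
    · intro hne
      -- `|Σ_m a^m z_m| ≤ M = N · B^d · A`
      have hM : (∑ μ, mval a μ * z μ).natAbs ≤ N * B ^ d * A := by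
        have h := abs_sum_mul_le (w := mval a) (z := z) (W := B ^ d) (A := A)
          (fun μ => by exact_mod_cast abs_mval_le hB1 (hH a ha) μ) hz
        rw [Int.abs_eq_natAbs] at h
        exact_mod_cast h
      obtain ⟨r, hr2, hrK, hndvd⟩ := exists_not_dvd_of_natAbs_le hne hM
      have hrK' : r ≤ numModuli N A B d := by
        rw [numModuli, show N * A * B ^ d = N * B ^ d * A by ring]; exact hrK
      refine ⟨r, ⟨hr2, hrK'⟩, ?_, ?_⟩
      · -- the proxy has modulus `≤ R = N · A · K`
        have h := abs_sum_mul_le (w := wmod a r) (z := z) (W := numModuli N A B d) (A := A)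
          (fun μ => (abs_wmod_le (by omega) a μ).trans (by exact_mod_cast hrK')) hz
        refine h.trans (le_of_eq ?_)
        rw [proxyRange]; push_cast; ring
      · intro hdvd
        apply hndvd
        have h2 := dvd_sub hdvd (dvd_sum_wmod_sub_sum_mval a r z)
        rwa [sub_sub_cancel] at h2
  rw [equation, map_mul, mul_eq_zero, eval_lam_intCast_eq_zero_iff, map_prod,
    Finset.prod_eq_zero_iff]
  simp_rw [map_prod, Finset.prod_eq_zero_iff]
  constructor
  · rintro (h0 | ⟨a, ha, hr⟩) hz0
    · exact absurd h0 hz0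
    · exact ⟨a, ha, (key a ha).mp hr⟩
  · intro h
    by_cases hz0 : z = 0
    · exact Or.inl hz0
    · obtain ⟨a, ha, hne⟩ := h hz0
      exact Or.inr ⟨a, ha, (key a ha).mpr hne⟩

/-! #### Size and degree of the equation -/

section Bounds

variable {ι : Type*} {α β : Type*}

omit [Field K] in
/-- Degree of a double product with uniformly bounded factors. [folklore] -/
private theorem totalDegree_prod_prod_le [CommSemiring K] (s : Finset α) (t : Finset β)
    (f : α → β → MvPolynomial ι K) (D : ℕ) (h : ∀ a ∈ s, ∀ b ∈ t, (f a b).totalDegree ≤ D) :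
    (∏ a ∈ s, ∏ b ∈ t, f a b).totalDegree ≤ s.card * (t.card * D) := by
  classical
  refine (totalDegree_finsetProd _ _).trans ?_
  rw [← smul_eq_mul, ← Finset.sum_const]
  refine Finset.sum_le_sum fun a ha => (totalDegree_finsetProd _ _).trans ?_
  rw [← smul_eq_mul, ← Finset.sum_const]
  exact Finset.sum_le_sum fun b hb => h a ha b hb

omit [Field K] in
/-- Size of a double product with uniformly bounded factors (one product gate per factor).
[cite: Burgisser2000, §2.1] -/
theorem complexity_prod_prod_le [CommSemiring K] (s : Finset α) (t : Finset β)
    (f : α → β → MvPolynomial ι K) (D : ℕ) (h : ∀ a ∈ s, ∀ b ∈ t, complexity (f a b) ≤ D) :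
    complexity (∏ a ∈ s, ∏ b ∈ t, f a b) ≤ s.card * (t.card * (D + 1) + 1) := by
  classical
  refine (complexity_finset_prod_le _ _).trans ?_
  have : ∀ a ∈ s, complexity (∏ b ∈ t, f a b) ≤ t.card * (D + 1) := by
    intro a ha
    refine (complexity_finset_prod_le _ _).trans ?_
    calc ∑ b ∈ t, complexity (f a b) + t.card ≤ ∑ _b ∈ t, D + t.card :=
          Nat.add_le_add_right (Finset.sum_le_sum fun b hb => h a ha b hb) _
      _ = t.card * (D + 1) := by rw [Finset.sum_const, smul_eq_mul]; ring
  calc ∑ a ∈ s, complexity (∏ b ∈ t, f a b) + s.card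
      ≤ ∑ _a ∈ s, t.card * (D + 1) + s.card :=
        Nat.add_le_add_right (Finset.sum_le_sum fun a ha => this a ha) _
    _ = s.card * (t.card * (D + 1) + 1) := by rw [Finset.sum_const, smul_eq_mul]; ring

/-- The number of moduli is `≤ 2W`, `W = log₂(N A B^d) + 2`. [folklore] -/
private theorem card_Icc_numModuli_le (N A B d : ℕ) :
    (Finset.Icc 2 (numModuli N A B d)).card ≤ 2 * (Nat.log 2 (N * A * B ^ d) + 2) := by
  rw [Nat.card_Icc, numModuli]; omega

/-- `2R + 1 ≤ 4 W (N A + 1)`. [folklore] -/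
private theorem two_mul_proxyRange_succ_le (N A B d : ℕ) :
    2 * proxyRange N A B d + 1 ≤ 4 * (Nat.log 2 (N * A * B ^ d) + 2) * (N * A + 1) := by
  rw [proxyRange]
  set W := Nat.log 2 (N * A * B ^ d) + 2 with hW
  have hK : numModuli N A B d ≤ 2 * W := by rw [hW, numModuli]; omega
  have h1 : N * A * numModuli N A B d ≤ N * A * (2 * W) := Nat.mul_le_mul_left _ hK
  have hW1 : 1 ≤ W := by omega
  nlinarith

variable [Fintype (monomialsDegLE n d)]

/-- **Degree of the equation**: `≤ 10 (|ℋ|+1) (N A + 1) W²`, `W = log₂(N A B^d) + 2` (print: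
`deg P_N ≤ B⁴ t N² log⁹ N` for large `n`, `A = 1`). [cite: ChatterjeeKumarRamyaSaptharishiTengse2020, Thm. 4.3 (arXiv v4), "Constructibility"] -/
theorem totalDegree_equation_le (A B : ℕ) (H : Finset (Fin n → ℤ)) :
    (equation K A B H : MvPolynomial (monomialsDegLE n d) K).totalDegree ≤
      10 * (H.card + 1) * (Fintype.card (monomialsDegLE n d) * A + 1) *
        (Nat.log 2 (Fintype.card (monomialsDegLE n d) * A * B ^ d) + 2) ^ 2 := by
  classical
  set N := Fintype.card (monomialsDegLE n d) with hN
  set W := Nat.log 2 (N * A * B ^ d) + 2 with hW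
  set X := N * A + 1 with hX
  have hW2 : 2 ≤ W := by omega
  have hX1 : 1 ≤ X := by omega
  have hprod : (∏ a ∈ H, ∏ r ∈ Finset.Icc 2 (numModuli N A B d),
      qFactor K (proxyRange N A B d) r (wmod (d := d) a r)).totalDegree ≤
      H.card * ((2 * W) * (4 * W * X)) := by
    refine (totalDegree_prod_prod_le _ _ _ (2 * proxyRange N A B d + 1)
      (fun a _ r _ => totalDegree_qFactor_le _ _ _)).trans ?_
    exact Nat.mul_le_mul_left _ (Nat.mul_le_mul (card_Icc_numModuli_le N A B d)
      (two_mul_proxyRange_succ_le N A B d))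
  rw [equation]
  refine (totalDegree_mul _ _).trans ?_
  refine (Nat.add_le_add totalDegree_lam_le hprod).trans ?_
  have hP : 4 ≤ W ^ 2 * X := by nlinarith
  calc 2 + H.card * (2 * W * (4 * W * X)) = 2 + 8 * H.card * (W ^ 2 * X) := by ring
    _ ≤ 10 * (H.card + 1) * X * W ^ 2 := by nlinarith [Nat.zero_le (H.card * (W ^ 2 * X))]

/-- **Size of the equation**: `≤ 20 (|ℋ|+1) (N A + 1) (N + 1) W²`, `W = log₂(N A B^d) + 2`
(print: "computable by a circuit of size at most `B⁴ · t · N⁴`" for large `n`, `A = 1`; the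
printed formula "immediately yields a circuit").
[cite: ChatterjeeKumarRamyaSaptharishiTengse2020, Thm. 4.3 (arXiv v4), "Constructibility"] -/
theorem complexity_equation_le (A B : ℕ) (H : Finset (Fin n → ℤ)) :
    complexity (equation K A B H : MvPolynomial (monomialsDegLE n d) K) ≤
      20 * (H.card + 1) * (Fintype.card (monomialsDegLE n d) * A + 1) *
        (Fintype.card (monomialsDegLE n d) + 1) *
        (Nat.log 2 (Fintype.card (monomialsDegLE n d) * A * B ^ d) + 2) ^ 2 := by
  classical
  set N := Fintype.card (monomialsDegLE n d) with hN
  set W := Nat.log 2 (N * A * B ^ d) + 2 with hW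
  set X := N * A + 1 with hX
  have hW2 : 2 ≤ W := by omega
  have hX1 : 1 ≤ X := by omega
  -- each CRT factor: `≤ (2R+1)(2N+2) ≤ 8 W X (N+1)`
  have hfac : ∀ a ∈ H, ∀ r ∈ Finset.Icc 2 (numModuli N A B d),
      complexity (qFactor K (proxyRange N A B d) r (wmod (d := d) a r)) ≤ 8 * W * X * (N + 1) := by
    intro a _ r _
    refine (complexity_qFactor_le _ _ _).trans ?_
    calc (2 * proxyRange N A B d + 1) * (2 * N + 2) ≤ (4 * W * X) * (2 * N + 2) :=
          Nat.mul_le_mul_right _ (two_mul_proxyRange_succ_le N A B d)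
      _ = 8 * W * X * (N + 1) := by ring
  have hprod := complexity_prod_prod_le H (Finset.Icc 2 (numModuli N A B d))
    (fun a r => qFactor K (proxyRange N A B d) r (wmod (d := d) a r)) _ hfac
  have hI := card_Icc_numModuli_le N A B d
  rw [equation]
  refine (complexity_mul_le_holds _ _).trans ?_
  refine (Nat.add_le_add_right (Nat.add_le_add complexity_lam_le hprod) _).trans ?_
  -- `(#moduli) (8WX(N+1) + 1) + 1 ≤ 2W (8WX(N+1) + 1) + 1 ≤ 18 W² X (N+1) + 1`
  have h1 : (Finset.Icc 2 (numModuli N A B d)).card * (8 * W * X * (N + 1) + 1) + 1 ≤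
      2 * W * (8 * W * X * (N + 1) + 1) + 1 :=
    Nat.add_le_add_right (Nat.mul_le_mul_right _ hI) _
  set Q := W ^ 2 * X * (N + 1) with hQdef
  have hQ : 4 * (N + 1) ≤ Q := by
    have : 4 ≤ W ^ 2 * X := by nlinarith
    exact Nat.mul_le_mul_right _ this
  have hQW : 2 * W + 1 ≤ 4 * Q := by
    have : W ^ 2 * 1 * 1 ≤ Q := by
      rw [hQdef]; exact Nat.mul_le_mul (Nat.mul_le_mul_left _ hX1) (by omega)
    nlinarith
  have htQ : H.card * (2 * W + 1) ≤ H.card * (4 * Q) := Nat.mul_le_mul_left _ hQW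
  have hR : 20 * (H.card + 1) * X * (N + 1) * W ^ 2 = 20 * (H.card * Q) + 20 * Q := by
    rw [hQdef]; ring
  calc 2 * N + H.card * ((Finset.Icc 2 (numModuli N A B d)).card * (8 * W * X * (N + 1) + 1) + 1) + 1
      ≤ 2 * N + H.card * (2 * W * (8 * W * X * (N + 1) + 1) + 1) + 1 := by
        gcongr
    _ = 2 * N + 1 + 16 * (H.card * Q) + H.card * (2 * W + 1) := by rw [hQdef]; ring
    _ ≤ 20 * (H.card + 1) * X * (N + 1) * W ^ 2 := by
        rw [hR]; nlinarith [htQ, hQ]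

end Bounds

end Points

end IntEquations

/-! ### v4 Thm. 4.3 in the tree's frame: integer-box coefficients, explicit bounds -/

section Main

variable (K : Type*) [Field K] [CharZero K]

/-- **CKRST 2020, arXiv v4 Thm. 4.3 ("Equations from hitting sets"), GENERAL COEFFICIENT BOX — the
construction and its exact vanishing locus.** For every finite `ℋ ⊆ [-B, B]^n ∩ ℤ^n` (`B ≥ 1`) and
every coefficient bound `A` there is a NONZERO polynomial `P` in the `N = |x^{≤ d}|` coefficient
variables, of size `≤ 20(|ℋ|+1)(NA+1)(N+1)W²` and degree `≤ 10(|ℋ|+1)(NA+1)W²`,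
`W = log₂(N·A·B^d) + 2`, such that for every `f` of degree `≤ d` whose coefficients are integers of
modulus `≤ A`: `P(coeff f) = 0` **iff** `f = 0` or `f(a) ≠ 0` for some `a ∈ ℋ`. In particular `P` is
an equation for `𝒞 ∩ {integer coefficients in [-A, A]}` for EVERY class `𝒞` of degree-`≤ d`
polynomials hit by `ℋ`, and `P(coeff g) ≠ 0` for every nonzero such `g` vanishing on `ℋ` (print's "A
remark on the largeness"). Print states the case `A = 1` (`Δ = {-1,0,1}`) with the bound
`B⁴ · t · N⁴` "for `n` large enough" and adds (before Thm. 4.3): "the proof would also generalize in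
a straightforward manner for polynomial families in `𝒞` whose coefficients are bounded by `N(n)`.
We state this for coefficients in `{-1,0,1}` just to avoid cumbersome notation" — this is that
generalization, with the dependence on the coefficient bound `A` explicit (LINEAR in `A`, i.e.
exponential in the bit-length: the quantity behind the route's coefficient-axis items
`SuccinctHittingSetsIffIntegerSlice` / `IntegerBoxVanishingTransfer`). Valid over any field of
characteristic zero (print: `ℂ`; "extend as is for rationals and reals", §3.1).
[cite: ChatterjeeKumarRamyaSaptharishiTengse2020, Thm. 4.3 (arXiv v4) and the paragraph preceding it] locator: HOME/lit/src/2004.14147/main.tex L1330–L1411 -/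
theorem exists_equation_intBox (n d A B : ℕ) (hB1 : 1 ≤ B) (H : Finset (Fin n → ℤ))
    (hH : ∀ a ∈ H, ∀ j, |a j| ≤ B) :
    ∃ P : MvPolynomial (monomialsDegLE n d) K, P ≠ 0 ∧
      complexity P ≤ 20 * (H.card + 1) * (Nat.card (monomialsDegLE n d) * A + 1) *
          (Nat.card (monomialsDegLE n d) + 1) *
          (Nat.log 2 (Nat.card (monomialsDegLE n d) * A * B ^ d) + 2) ^ 2 ∧
      P.totalDegree ≤ 10 * (H.card + 1) * (Nat.card (monomialsDegLE n d) * A + 1) *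
          (Nat.log 2 (Nat.card (monomialsDegLE n d) * A * B ^ d) + 2) ^ 2 ∧
      ∀ f : MvPolynomial (Fin n) K, f.totalDegree ≤ d →
        (∀ m, ∃ z : ℤ, coeff m f = (z : K) ∧ |z| ≤ A) →
        (eval (coeffVector (monomialsDegLE n d) f) P = 0 ↔
          (f ≠ 0 → ∃ a ∈ H, eval (fun j => ((a j : ℤ) : K)) f ≠ 0)) := by
  classical
  haveI : Fintype (monomialsDegLE n d) := (Finsupp.finite_of_degree_le (σ := Fin n) d).fintype
  simp_rw [Nat.card_eq_fintype_card]
  refine ⟨IntEquations.equation K A B H, IntEquations.equation_ne_zero A B H,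
    IntEquations.complexity_equation_le A B H, IntEquations.totalDegree_equation_le A B H,
    fun f hdeg hcoef => ?_⟩
  choose z hz using hcoef
  -- the coefficient vector is the integer vector `z` on `x^{≤ d}`
  have hcv : coeffVector (monomialsDegLE n d) f =
      fun μ : monomialsDegLE n d => ((z (μ : Fin n →₀ ℕ) : ℤ) : K) :=
    funext fun μ => (hz μ).1
  rw [hcv, IntEquations.eval_equation_eq_zero_iff hB1 hH (fun μ => z μ) (fun μ => (hz μ).2)]
  -- `f = 0 ↔ z|_{x^{≤ d}} = 0`
  have hf0 : f = 0 ↔ (fun μ : monomialsDegLE n d => z μ) = 0 := by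
    constructor
    · intro h
      funext μ
      have := (hz μ).1
      rw [h, coeff_zero] at this
      exact_mod_cast this.symm
    · intro h
      refine MvPolynomial.eq_zero_iff.mpr fun m => ?_
      by_cases hm : m.degree ≤ d
      · have := congrFun h ⟨m, hm⟩
        simp only [Pi.zero_apply] at this
        rw [(hz m).1, this, Int.cast_zero]
      · refine coeff_eq_zero_of_totalDegree_lt ?_
        rw [← Finsupp.degree_apply]
        omega
  -- `f(a) = Σ_m a^m z_m`
  have heval : ∀ a : Fin n → ℤ, eval (fun j => ((a j : ℤ) : K)) f =
      ((∑ μ : monomialsDegLE n d, IntEquations.mval a μ * z μ : ℤ) : K) := by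
    intro a
    have h := FiniteFields.eval_map_eq_sum_coeffVector (F := K) (K := K)
      (fun j => ((a j : ℤ) : K)) hdeg
    rw [Algebra.algebraMap_self, MvPolynomial.map_id] at h
    rw [h]
    push_cast
    refine Finset.sum_congr rfl fun μ _ => ?_
    rw [coeffVector_apply, (hz μ).1, smul_eq_mul, IntEquations.mval]
    push_cast
    ring
  simp only [ne_eq, hf0, heval, Int.cast_eq_zero]

omit [CharZero K] in
/-- Polynomials with coefficients in `{-1, 0, 1}` have integer coefficients of modulus `≤ 1`.
[folklore] -/
private theorem intBox_one_of_mem_signCoeffSlice {n : ℕ} {f : MvPolynomial (Fin n) K}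
    (hf : f ∈ signCoeffSlice K n) (m : Fin n →₀ ℕ) :
    ∃ z : ℤ, coeff m f = (z : K) ∧ |z| ≤ ((1 : ℕ) : ℤ) := by
  rcases hf m with h | h | h
  · exact ⟨0, by rw [h, Int.cast_zero], by simp⟩
  · exact ⟨1, by rw [h, Int.cast_one], by simp⟩
  · exact ⟨-1, by rw [h, Int.cast_neg, Int.cast_one], by simp⟩

/-- For `n ≥ 1` there are at least `d + 1` monomials of degree `≤ d` (`x₀^j`, `j ≤ d`), so
`d < N`. [folklore] -/
private theorem succ_le_card_monomialsDegLE {n : ℕ} (hn : 1 ≤ n) (d : ℕ) :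
    d + 1 ≤ Nat.card (monomialsDegLE n d) := by
  classical
  haveI : Fintype (monomialsDegLE n d) := (Finsupp.finite_of_degree_le (σ := Fin n) d).fintype
  rw [Nat.card_eq_fintype_card]
  let ι : Fin (d + 1) → monomialsDegLE n d := fun j =>
    ⟨Finsupp.single ⟨0, hn⟩ (j : ℕ), by
      change Finsupp.degree _ ≤ d
      rw [Finsupp.degree_single]; omega⟩
  have hι : Function.Injective ι := by
    intro j j' h
    have := congrArg (fun μ : monomialsDegLE n d => (μ : Fin n →₀ ℕ) ⟨0, hn⟩) h
    simp only [ι, Finsupp.single_eq_same] at this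
    exact Fin.ext this
  simpa using Fintype.card_le_of_injective ι hι

/-- `log₂(N · A · B^d) + 2 ≤ N + A + B·d + 2` (crude: `x ≤ 2^x`). [folklore] -/
private theorem log_two_add_two_le (N A B d : ℕ) :
    Nat.log 2 (N * A * B ^ d) + 2 ≤ N + A + B * d + 2 := by
  have h1 : N ≤ 2 ^ N := Nat.lt_two_pow_self.le
  have h2 : A ≤ 2 ^ A := Nat.lt_two_pow_self.le
  have h3 : B ^ d ≤ 2 ^ (B * d) := by
    rw [pow_mul]; exact Nat.pow_le_pow_left Nat.lt_two_pow_self.le _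
  have h : N * A * B ^ d ≤ 2 ^ (N + A + B * d) := by
    rw [pow_add, pow_add]
    exact Nat.mul_le_mul (Nat.mul_le_mul h1 h2) h3
  have := Nat.log_mono_right (b := 2) h
  rw [Nat.log_pow Nat.one_lt_two] at this
  omega

/-- **CKRST 2020, arXiv v4 Thm. 4.3 in the printed shape** ("Equations from hitting sets"): "Let `n`
be large enough, and let `𝒞 ⊆ ℂ[x₁,…,x_n]` be a set of polynomials of degree at most `d`, and let
`ℋ ⊆ {1,2,…,B}^n` be a hitting set for `𝒞` of size `t`. Then, for `N = binom(n+d, d)`, and for `𝒞'`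
being the set of all polynomials in `𝒞` with coefficients in `{-1,0,1}`, there is an equation
`P_N(Z₁,…,Z_N) ≢ 0` for `𝒞'`, with `deg(P_N)` and `size(P_N)` at most `B⁴ · t · N⁴`." Typed for
every `n ≥ 1`, `B ≥ 1`, `ℋ ⊆ [-B, B]^n ∩ ℤ^n`, with an absolute constant `c` and `t + 1` in place
of the print's "`n` large enough" and `t` (the print's bound is `0` at `t = 0`, where `P = OR(z)`
still has positive size; `c = 1280`); plus the print's "remark on the largeness": `P` is nonzero at
every nonzero `g ∈ 𝒞'`-shape polynomial vanishing on `ℋ`.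
[cite: ChatterjeeKumarRamyaSaptharishiTengse2020, Thm. 4.3 (arXiv v4)] locator: HOME/lit/src/2004.14147/main.tex L1334–L1338; paper:arxiv-2004.14147 p0011.txt (v2 §4) -/
theorem thm_4_3 : ∃ c : ℕ, ∀ (n d B : ℕ) (𝒞 : Set (MvPolynomial (Fin n) K))
    (H : Finset (Fin n → ℤ)), 1 ≤ n → 1 ≤ B → (∀ a ∈ H, ∀ j, |a j| ≤ B) →
    (∀ f ∈ 𝒞, f.totalDegree ≤ d) →
    (∀ f ∈ 𝒞, f ≠ 0 → ∃ a ∈ H, eval (fun j => ((a j : ℤ) : K)) f ≠ 0) →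
    ∃ P : MvPolynomial (monomialsDegLE n d) K, P ≠ 0 ∧
      complexity P ≤ c * B ^ 4 * (H.card + 1) * Nat.card (monomialsDegLE n d) ^ 4 ∧
      P.totalDegree ≤ c * B ^ 4 * (H.card + 1) * Nat.card (monomialsDegLE n d) ^ 4 ∧
      (∀ f ∈ 𝒞, f ∈ signCoeffSlice K n → eval (coeffVector (monomialsDegLE n d) f) P = 0) ∧
      (∀ g : MvPolynomial (Fin n) K, g.totalDegree ≤ d → g ∈ signCoeffSlice K n → g ≠ 0 →
        (∀ a ∈ H, eval (fun j => ((a j : ℤ) : K)) g = 0) →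
        eval (coeffVector (monomialsDegLE n d) g) P ≠ 0) := by
  refine ⟨1280, fun n d B 𝒞 H hn hB1 hH hdeg hhit => ?_⟩
  obtain ⟨P, hP0, hPL, hPdeg, hPiff⟩ := exists_equation_intBox K n d 1 B hB1 H hH
  set N := Nat.card (monomialsDegLE n d) with hN
  have hdN : d + 1 ≤ N := succ_le_card_monomialsDegLE hn d
  -- `W ≤ 4 B N`
  have hW : Nat.log 2 (N * 1 * B ^ d) + 2 ≤ 4 * B * N := by
    refine (log_two_add_two_le N 1 B d).trans ?_
    have : B * d + 3 ≤ B * N + 2 * B * N := by nlinarith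
    nlinarith
  have hB2 : B ^ 2 ≤ B ^ 4 := Nat.pow_le_pow_right hB1 (by norm_num)
  refine ⟨P, hP0, hPL.trans ?_, hPdeg.trans ?_, fun f hf hfs => ?_, fun g hg hgs hg0 hgv => ?_⟩
  · -- size
    calc 20 * (H.card + 1) * (N * 1 + 1) * (N + 1) * (Nat.log 2 (N * 1 * B ^ d) + 2) ^ 2
        ≤ 20 * (H.card + 1) * (2 * N) * (2 * N) * (4 * B * N) ^ 2 := by
          gcongr <;> omega
      _ = 1280 * B ^ 2 * (H.card + 1) * N ^ 4 := by ring
      _ ≤ 1280 * B ^ 4 * (H.card + 1) * N ^ 4 := by gcongr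
  · -- degree
    calc 10 * (H.card + 1) * (N * 1 + 1) * (Nat.log 2 (N * 1 * B ^ d) + 2) ^ 2
        ≤ 10 * (H.card + 1) * (2 * N) * (4 * B * N) ^ 2 := by gcongr; omega
      _ = 320 * B ^ 2 * (H.card + 1) * N ^ 3 := by ring
      _ ≤ 1280 * B ^ 4 * (H.card + 1) * N ^ 4 := by
          have : N ^ 3 ≤ N ^ 4 := Nat.pow_le_pow_right (by omega) (by norm_num)
          gcongr
          omega
  · exact (hPiff f (hdeg f hf) (intBox_one_of_mem_signCoeffSlice K hfs)).mpr (hhit f hf)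
  · intro h
    obtain ⟨a, ha, hne⟩ := (hPiff g hg (intBox_one_of_mem_signCoeffSlice K hgs)).mp h hg0
    exact hne (hgv a ha)

/-! ### v4 Thm. 4.1 (finite fields) — by name from `CKRST20FiniteFieldsProofs.lean` -/

/-- **CKRST 2020, arXiv v4 Thm. 4.1 ("Hitting sets give equations", finite fields).** "Let `𝔽` be a
finite field of size `q`, and let `n` be large enough. For some `d ≥ 1`, let `𝕂` be an extension of
`𝔽`, of size at least `d²`. Let `𝒞 ⊆ 𝔽[x₁,…,x_n]` be a set of polynomials of degree at most `d`,
and let `ℋ ⊂ 𝕂^n` be a hitting set for `𝒞`, of size `|ℋ| = t`. Then, for `N = binom(n+d, d)`,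
there is an equation `P_N(Z₁,…,Z_N) ≢ 0` for `𝒞'` [sic; = `𝒞`], with `deg(P_N)` and `size(P_N)` at
most `10 · q · N · t · (log d)`." (proof: `r_d = [𝕂 : 𝔽] = a · log d` for some `a ≤ 2`,
`P_N = OR(z) · ∏_{a ∈ ℋ} ∏_{i=1}^{r_d} (1 - (Σ_m z_m eval(a)^{(i)}_m)^{q-1})`, size `≤ 4 q t r_d N`.)
This is t19's `CKRST2020.FiniteFields.exists_equation` (the engine of `CKRST2020_thm_1_2_holds`)
stated at class level: typed for ANY finite extension `𝕂 ⊇ 𝔽` with `r = [𝕂 : 𝔽]` in place of the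
print's `log d` (the hypothesis `|𝕂| ≥ d²` is only needed to HAVE small hitting sets; the printed
`10 q N t log d` is `0` at `d = 1` — excluded by "large enough"), bounds `10 · q · N · (r t + 1)`;
`P ≢ 0` as a polynomial (as printed): when `r · t < N` the printed `P` has a non-root `h` of degree
`≤ d` (print's "remark on the largeness"); when `r · t ≥ N` the Fermat polynomial `z_{μ₀}^q - z_{μ₀}`
(nonzero, vanishing on all of `𝔽^N`, size `≤ q + 2`) is an equation for every class — a non-ROOT of
an equation exists only in the first regime (last clause).
[cite: ChatterjeeKumarRamyaSaptharishiTengse2020, Thm. 4.1 (arXiv v4) = v2 §3] locator: HOME/lit/src/2004.14147/main.tex L1246–L1253; paper:arxiv-2004.14147 p0010.txt:L19 -/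
theorem thm_4_1 (F : Type*) [Field F] [Fintype F] (L : Type*) [Field L] [Algebra F L]
    [FiniteDimensional F L] (n d : ℕ) (𝒞 : Set (MvPolynomial (Fin n) F)) (H : Finset (Fin n → L))
    (hdeg : ∀ f ∈ 𝒞, f.totalDegree ≤ d)
    (hhit : ∀ f ∈ 𝒞, f ≠ 0 → ∃ a ∈ H, eval a (MvPolynomial.map (algebraMap F L) f) ≠ 0) :
    ∃ P : MvPolynomial (monomialsDegLE n d) F, P ≠ 0 ∧
      complexity P ≤ 10 * Fintype.card F * Nat.card (monomialsDegLE n d) *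
          (Module.finrank F L * H.card + 1) ∧
      P.totalDegree ≤ 10 * Fintype.card F * Nat.card (monomialsDegLE n d) *
          (Module.finrank F L * H.card + 1) ∧
      (∀ f ∈ 𝒞, eval (coeffVector (monomialsDegLE n d) f) P = 0) ∧
      (Module.finrank F L * H.card < Nat.card (monomialsDegLE n d) →
        ∃ h : MvPolynomial (Fin n) F, h.totalDegree ≤ d ∧
          eval (coeffVector (monomialsDegLE n d) h) P ≠ 0) := by
  classical
  haveI : Fintype (monomialsDegLE n d) := (Finsupp.finite_of_degree_le (σ := Fin n) d).fintype
  simp_rw [Nat.card_eq_fintype_card]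
  let μ₀ : monomialsDegLE n d := ⟨0, by change Finsupp.degree _ ≤ d; simp⟩
  have hN1 : 1 ≤ Fintype.card (monomialsDegLE n d) := Fintype.card_pos_iff.mpr ⟨μ₀⟩
  have hq2 : 2 ≤ Fintype.card F := Fintype.one_lt_card
  by_cases hlt : Module.finrank F L * H.card < Fintype.card (monomialsDegLE n d)
  · -- the printed polynomial (t19's `FiniteFields.exists_equation`), nonzero by its non-root
    obtain ⟨P, hL, hD, hvan, hwit⟩ :=
      FiniteFields.exists_equation (F := F) (K := L) (n := n) (d := d) H
    obtain ⟨h, hhd, hhP⟩ := hwit hlt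
    have hP0 : P ≠ 0 := by
      rintro rfl
      exact hhP (map_zero _)
    refine ⟨P, hP0, hL.trans ?_, hD.trans ?_, fun f hf => hvan f (hdeg f hf) (hhit f hf),
      fun _ => ⟨h, hhd, hhP⟩⟩
    · gcongr; norm_num
    · set N := Fintype.card (monomialsDegLE n d)
      set q := Fintype.card F
      nlinarith [Nat.zero_le (q * (Module.finrank F L * H.card)), Nat.zero_le (q * N)]
  · -- `r t ≥ N`: the Fermat polynomial `z_{μ₀}^q - z_{μ₀}`, nonzero and vanishing on all of `F^N`
    refine ⟨X μ₀ ^ Fintype.card F - X μ₀, ?_, ?_, ?_, ?_, fun h => absurd h hlt⟩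
    · -- nonzero: the coefficient of the monomial `z_{μ₀}` is `-1`
      have hne : Finsupp.single μ₀ (Fintype.card F) ≠ Finsupp.single μ₀ 1 := by
        intro h
        have := Finsupp.single_injective μ₀ h
        omega
      intro h0
      have hc := congrArg (coeff (Finsupp.single μ₀ 1)) h0
      simp only [coeff_sub, coeff_zero, coeff_X_pow, coeff_X, if_neg hne, zero_sub,
        neg_eq_zero] at hc
      exact one_ne_zero hc
    · -- size `≤ q + 2`
      have hX : complexity (X μ₀ : MvPolynomial (monomialsDegLE n d) F) = 0 := complexity_X_holds μ₀
      have hC : complexity (C (-1) : MvPolynomial (monomialsDegLE n d) F) = 0 := complexity_C_holds _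
      have hrepr : (X μ₀ ^ Fintype.card F - X μ₀ : MvPolynomial (monomialsDegLE n d) F) =
          (∏ _i ∈ Finset.range (Fintype.card F), X μ₀) + C (-1) * X μ₀ := by
        rw [Finset.prod_const, Finset.card_range, map_neg, map_one]; ring
      rw [hrepr]
      have h1 : complexity (∏ _i ∈ Finset.range (Fintype.card F),
          (X μ₀ : MvPolynomial (monomialsDegLE n d) F)) ≤ Fintype.card F := by
        refine (complexity_finset_prod_le _ _).trans ?_
        simp [hX]
      have h2 : complexity (C (-1) * X μ₀ : MvPolynomial (monomialsDegLE n d) F) ≤ 1 := by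
        refine (complexity_mul_le_holds _ _).trans ?_
        rw [hC, hX]
      refine (complexity_add_le_holds _ _).trans ?_
      have h3 : Fintype.card F + 1 + 1 ≤ 10 * Fintype.card F * Fintype.card (monomialsDegLE n d) *
          (Module.finrank F L * H.card + 1) := by
        have : 10 * Fintype.card F ≤ 10 * Fintype.card F * Fintype.card (monomialsDegLE n d) *
            (Module.finrank F L * H.card + 1) := by
          rw [mul_assoc (10 * Fintype.card F)]
          exact Nat.le_mul_of_pos_right _ (Nat.mul_pos hN1 (Nat.succ_pos _))
        omega
      exact le_trans (Nat.add_le_add_right (Nat.add_le_add h1 h2) _) h3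
    · -- degree `≤ q`
      refine (totalDegree_sub _ _).trans ?_
      rw [totalDegree_X_pow, totalDegree_X, max_eq_left (by omega)]
      calc Fintype.card F ≤ 10 * Fintype.card F := by omega
        _ ≤ 10 * Fintype.card F * Fintype.card (monomialsDegLE n d) *
            (Module.finrank F L * H.card + 1) := by
          rw [mul_assoc (10 * Fintype.card F)]
          exact Nat.le_mul_of_pos_right _ (Nat.mul_pos hN1 (Nat.succ_pos _))
    · -- vanishing at EVERY coefficient vector (`x^q = x` on `𝔽`)
      intro f _
      simp only [map_sub, map_pow, eval_X]
      rw [FiniteField.pow_card, sub_self]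

/-! ### Consequences over `ℂ`: equations for the integer-box parts of the `VP` slices (Thm. 1.6's
mechanism at a fixed `n`, general coefficient bound), and v4 Thm. 4.2 -/

omit [CharZero K] in
/-- Points of `K^n` whose coordinates are casts of naturals in `[1, B]` lift to integer points of
`[1, B]^n`. [folklore] -/
private theorem exists_int_points {n : ℕ} (B : ℕ) (H : Finset (Fin n → K))
    (hH : ∀ a ∈ H, ∀ i, ∃ k : ℕ, k ∈ Finset.Icc 1 B ∧ (k : K) = a i) :
    ∃ H' : Finset (Fin n → ℤ), H'.card ≤ H.card ∧ (∀ a ∈ H', ∀ i, 1 ≤ a i ∧ a i ≤ B) ∧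
      ∀ a ∈ H, ∃ a' ∈ H', (fun j => ((a' j : ℤ) : K)) = a := by
  classical
  let lift : K → ℤ := fun x =>
    if h : ∃ k : ℕ, k ∈ Finset.Icc 1 B ∧ (k : K) = x then (h.choose : ℤ) else 0
  have hlift : ∀ x : K, (∃ k : ℕ, k ∈ Finset.Icc 1 B ∧ (k : K) = x) →
      (1 ≤ lift x ∧ lift x ≤ B) ∧ ((lift x : ℤ) : K) = x := by
    intro x hx
    have hspec := hx.choose_spec
    simp only [lift, dif_pos hx]
    rw [Finset.mem_Icc] at hspec
    refine ⟨⟨by exact_mod_cast hspec.1.1, by exact_mod_cast hspec.1.2⟩, ?_⟩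
    rw [Int.cast_natCast]; exact hspec.2
  refine ⟨H.image fun a j => lift (a j), Finset.card_image_le, ?_, ?_⟩
  · intro a' ha' i
    obtain ⟨a, ha, rfl⟩ := Finset.mem_image.mp ha'
    exact (hlift (a i) (hH a ha i)).1
  · intro a ha
    refine ⟨fun j => lift (a j), Finset.mem_image_of_mem _ ha, funext fun j => ?_⟩
    exact (hlift (a j) (hH a ha j)).2

/-- **Equations for `𝒞(n,d,s) ∩ {integer coefficients in [-A, A]}` over `ℂ`** (Thm. 1.6's mechanism
at a fixed `n`, with the coefficient bound as a parameter): from the Heintz–Schnorr hitting set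
`ℋ ⊆ [(sd)²]^n`, `|ℋ| ≤ s^e` (`CKRST2020_lemma12_holds`, v4 Lemma 3.6 = [HS80a]) and
`exists_equation_intBox`: one exponent `e` such that for `1 ≤ n ≤ s`, `1 ≤ d ≤ s`, `s ≥ 2` and
every `A` there are `ℋ` and `P ≠ 0` with `size(P) ≤ 20(s^e+1)(NA+1)(N+1)W²`,
`deg(P) ≤ 10(s^e+1)(NA+1)W²`, `W = log₂(N·A·(sd)^{2d}) + 2`, vanishing at `coeff(f)` for every
`f ∈ vpSlice ℂ n d s` with integer coefficients of modulus `≤ A`, and nonzero at every nonzero such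
polynomial of degree `≤ d` vanishing on `ℋ`. (Polynomial in `N`, `s`, and LINEAR in `A`.)
[cite: ChatterjeeKumarRamyaSaptharishiTengse2020, Thm. 1.6 (arXiv v4, proof) with the paragraph before Thm. 4.3] -/
theorem exists_equation_vpSlice_intBox : ∃ e : ℕ, ∀ (n d s A : ℕ), 1 ≤ n → n ≤ s → 1 ≤ d →
    d ≤ s → 2 ≤ s →
    ∃ (H : Finset (Fin n → ℤ)) (P : MvPolynomial (monomialsDegLE n d) ℂ),
      (∀ a ∈ H, ∀ i, 1 ≤ a i ∧ a i ≤ ((s * d) ^ 2 : ℕ)) ∧ H.card ≤ s ^ e ∧ P ≠ 0 ∧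
      complexity P ≤ 20 * (s ^ e + 1) * (Nat.card (monomialsDegLE n d) * A + 1) *
          (Nat.card (monomialsDegLE n d) + 1) *
          (Nat.log 2 (Nat.card (monomialsDegLE n d) * A * ((s * d) ^ 2) ^ d) + 2) ^ 2 ∧
      P.totalDegree ≤ 10 * (s ^ e + 1) * (Nat.card (monomialsDegLE n d) * A + 1) *
          (Nat.log 2 (Nat.card (monomialsDegLE n d) * A * ((s * d) ^ 2) ^ d) + 2) ^ 2 ∧
      (∀ f : MvPolynomial (Fin n) ℂ, f.totalDegree ≤ d →
        (∀ m, ∃ z : ℤ, coeff m f = (z : ℂ) ∧ |z| ≤ A) →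
        (eval (coeffVector (monomialsDegLE n d) f) P = 0 ↔
          (f ≠ 0 → ∃ a ∈ H, eval (fun j => ((a j : ℤ) : ℂ)) f ≠ 0))) ∧
      (∀ f ∈ vpSlice ℂ n d s, (∀ m, ∃ z : ℤ, coeff m f = (z : ℂ) ∧ |z| ≤ A) →
        eval (coeffVector (monomialsDegLE n d) f) P = 0) := by
  obtain ⟨e, h12⟩ := CKRST2020_lemma12_holds
  refine ⟨e, fun n d s A hn hns hd hds hs => ?_⟩
  obtain ⟨H, hHB, hHcard, hHhit⟩ := h12 n d s hn hns hd hds hs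
  have hB1 : 1 ≤ (s * d) ^ 2 := Nat.one_le_pow _ _ (Nat.mul_pos (by omega) (by omega))
  have hHabs : ∀ a ∈ H, ∀ j, |a j| ≤ ((s * d) ^ 2 : ℕ) := by
    intro a ha j
    obtain ⟨h1, h2⟩ := hHB a ha j
    rw [abs_le]; constructor <;> linarith
  obtain ⟨P, hP0, hPL, hPdeg, hPiff⟩ := exists_equation_intBox ℂ n d A ((s * d) ^ 2) hB1 H hHabs
  refine ⟨H, P, hHB, hHcard, hP0, hPL.trans ?_, hPdeg.trans ?_, hPiff, fun f hf hbox => ?_⟩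
  · gcongr
  · gcongr
  · exact (hPiff f hf.1 hbox).mpr (hHhit f hf)

/-- `log₂((2d)^n · D + 1) ≤ 2dn + log₂ D + 1` for `d ≥ 1`. [folklore] -/
private theorem log_two_hittingSetCount_le {n d : ℕ} (hd : 1 ≤ d) (D : ℕ) :
    Nat.log 2 ((2 * d) ^ n * D + 1) ≤ 2 * d * n + Nat.log 2 D + 1 := by
  have h1 : (2 * d) ^ n ≤ 2 ^ (2 * d * n) := by
    rw [pow_mul]; exact Nat.pow_le_pow_left Nat.lt_two_pow_self.le _
  have h2 : D + 1 ≤ 2 ^ (Nat.log 2 D + 1) := Nat.lt_pow_succ_log_self Nat.one_lt_two D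
  have h3 : 1 ≤ (2 * d) ^ n := Nat.one_le_pow _ _ (by omega)
  have h : (2 * d) ^ n * D + 1 ≤ 2 ^ (2 * d * n + Nat.log 2 D + 1) := by
    calc (2 * d) ^ n * D + 1 ≤ (2 * d) ^ n * (D + 1) := by nlinarith
      _ ≤ 2 ^ (2 * d * n) * 2 ^ (Nat.log 2 D + 1) := Nat.mul_le_mul h1 h2
      _ = 2 ^ (2 * d * n + Nat.log 2 D + 1) := by ring
  have := Nat.log_mono_right (b := 2) h
  rwa [Nat.log_pow Nat.one_lt_two] at this

/-- For `d ≥ 1` there are at least `n + 1` monomials of degree `≤ d` (`1` and the `x_i`), so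
`n < N`. [folklore] -/
private theorem succ_le_card_monomialsDegLE' (n : ℕ) {d : ℕ} (hd : 1 ≤ d) :
    n + 1 ≤ Nat.card (monomialsDegLE n d) := by
  classical
  haveI : Fintype (monomialsDegLE n d) := (Finsupp.finite_of_degree_le (σ := Fin n) d).fintype
  rw [Nat.card_eq_fintype_card]
  let ι : Option (Fin n) → monomialsDegLE n d := fun o => o.elim
    ⟨0, by change Finsupp.degree _ ≤ d; simp⟩
    (fun i => ⟨Finsupp.single i 1, by
      change Finsupp.degree _ ≤ d
      rw [Finsupp.degree_single]; exact hd⟩)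
  have hι : Function.Injective ι := by
    intro o o' h
    have hv := congrArg (fun μ : monomialsDegLE n d => (μ : Fin n →₀ ℕ)) h
    rcases o with _ | i <;> rcases o' with _ | i'
    · rfl
    · simp only [ι, Option.elim] at hv
      exact absurd (hv ▸ rfl : Finsupp.single i' 1 i' = (0 : Fin n →₀ ℕ) i') (by simp)
    · simp only [ι, Option.elim] at hv
      exact absurd (hv ▸ rfl : (0 : Fin n →₀ ℕ) i = Finsupp.single i 1 i) (by simp)
    · simp only [ι, Option.elim] at hv
      exact congrArg some ((Finsupp.single_left_injective one_ne_zero) hv)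
  have := Fintype.card_le_of_injective ι hι
  simpa [Fintype.card_option] using this

/-- **CKRST 2020, arXiv v4 Thm. 4.2 ("Equations from universal polynomials").** "Let
`𝒞 ⊆ ℂ[x₁,…,x_n]` be a set of polynomials of degree at most `d`, and suppose for `N = binom(n+d, d)`
there is a universal polynomial `U(y₁,…,y_m)(x)` of total degree `D` that generates all
polynomials from `𝒞`. That is, for each `f ∈ 𝒞`, there is an `α ∈ ℂ^m` such that
`U(y = α)(x) = f(x)`. Then for `𝒞'` being the set of all polynomials in `𝒞` with coefficients in
`{-1,0,1}`, there is an equation `P_N(Z₁,…,Z_N) ≢ 0` for `𝒞'`, with `deg(P_N), size(P_N) = poly(N)`."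
Typed with the universal polynomial as its coefficient map `U : x^{≤ d} → ℂ[y₁,…,y_m]`
(`deg_y U_m ≤ D`), for `n, d ≥ 1`, and with the print's unquantified `poly(N)` made explicit as
`c · (m+1) · (log₂ D + 1) · N⁸` (the hitting set comes from the tree's PROVED Rónyai–Babai–Ganapathy
form of v4 Thm. 3.1, `CoeffCover.exists_hittingSet`: `ℋ ⊆ [2d]^n`, `|ℋ| ≤ m(log₂((2d)^n D + 1) + 1) + 1`
— the print's route is Thm. 3.1 = [HS80a] with `|ℋ|` independent of `n`, not in the tree; either
way `poly(N) · m · log D`). Any field of characteristic zero.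
[cite: ChatterjeeKumarRamyaSaptharishiTengse2020, Thm. 4.2 (arXiv v4)] locator: HOME/lit/src/2004.14147/main.tex L1322–L1327 -/
theorem thm_4_2 : ∃ c : ℕ, ∀ (n d m D : ℕ) (U : monomialsDegLE n d → MvPolynomial (Fin m) K)
    (𝒞 : Set (MvPolynomial (Fin n) K)), 1 ≤ n → 1 ≤ d → (∀ μ, (U μ).totalDegree ≤ D) →
    (∀ f ∈ 𝒞, f.totalDegree ≤ d) →
    (∀ f ∈ 𝒞, ∃ y : Fin m → K, ∀ μ, eval y (U μ) = coeff (μ : Fin n →₀ ℕ) f) →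
    ∃ P : MvPolynomial (monomialsDegLE n d) K, P ≠ 0 ∧
      complexity P ≤ c * (m + 1) * (Nat.log 2 D + 1) * Nat.card (monomialsDegLE n d) ^ 8 ∧
      P.totalDegree ≤ c * (m + 1) * (Nat.log 2 D + 1) * Nat.card (monomialsDegLE n d) ^ 8 ∧
      ∀ f ∈ 𝒞, f ∈ signCoeffSlice K n → eval (coeffVector (monomialsDegLE n d) f) P = 0 := by
  classical
  refine ⟨8640, fun n d m D U 𝒞 hn hd hU hdeg hgen => ?_⟩
  -- the grid `S = {1, …, 2d} ⊂ K` and the tree's hitting set for the class generated by `U`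
  set S : Finset K := (Finset.Icc 1 (2 * d)).image (fun k : ℕ => (k : K)) with hS
  have hScard : S.card = 2 * d := by
    rw [hS, Finset.card_image_of_injective _ Nat.cast_injective, Nat.card_Icc]; omega
  have hS1 : S.Nonempty := Finset.card_pos.mp (by omega)
  obtain ⟨H, hHS, hHcard, hHhit⟩ := CoeffCover.exists_hittingSet (F := K) n d m D
    (Finsupp.finite_of_degree_le (σ := Fin n) d) U hU S hS1 hScard.ge
  -- integer lift of the points
  have hHnat : ∀ a ∈ H, ∀ i, ∃ k : ℕ, k ∈ Finset.Icc 1 (2 * d) ∧ (k : K) = a i := by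
    intro a ha i
    have := hHS a ha i
    rw [hS, Finset.mem_image] at this
    obtain ⟨k, hk, hka⟩ := this
    exact ⟨k, hk, hka⟩
  obtain ⟨H', hH'card, hH'B, hH'lift⟩ := exists_int_points K (2 * d) H hHnat
  have hB1 : 1 ≤ 2 * d := by omega
  have hH'abs : ∀ a ∈ H', ∀ j, |a j| ≤ ((2 * d : ℕ) : ℤ) := by
    intro a ha j
    obtain ⟨h1, h2⟩ := hH'B a ha j
    rw [abs_le]; constructor <;> linarith
  obtain ⟨P, hP0, hPL, hPdeg, hPiff⟩ := exists_equation_intBox K n d 1 (2 * d) hB1 H' hH'abs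
  -- vanishing on `𝒞 ∩ {-1,0,1}`-coefficients
  have hvan : ∀ f ∈ 𝒞, f ∈ signCoeffSlice K n →
      eval (coeffVector (monomialsDegLE n d) f) P = 0 := by
    intro f hf hfs
    refine (hPiff f (hdeg f hf) (intBox_one_of_mem_signCoeffSlice K hfs)).mpr fun hf0 => ?_
    obtain ⟨a, ha, hne⟩ := hHhit f (hdeg f hf) (hgen f hf) hf0
    obtain ⟨a', ha', rfl⟩ := hH'lift a ha
    exact ⟨a', ha', hne⟩
  -- bookkeeping: `N ≥ n + 1`, `N ≥ d + 1`, `|ℋ'| + 1 ≤ 3 (m+1)(log₂ D + 1) N²`, `W ≤ 6 N²`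
  set N := Nat.card (monomialsDegLE n d) with hN
  have hnN : n + 1 ≤ N := succ_le_card_monomialsDegLE' n hd
  have hdN : d + 1 ≤ N := succ_le_card_monomialsDegLE hn d
  set Lg := Nat.log 2 D with hLg
  have ht : H'.card + 1 ≤ 3 * ((m + 1) * (Lg + 1) * N ^ 2) := by
    have h1 := log_two_hittingSetCount_le (n := n) hd D
    rw [hScard] at hHcard
    have hX : 2 * d * n + Lg + 2 ≤ 3 * ((Lg + 1) * N ^ 2) := by
      have hNN : (d + 1) * (n + 1) ≤ N ^ 2 := by rw [sq]; exact Nat.mul_le_mul hdN hnN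
      have hL : Lg ≤ Lg * N ^ 2 := Nat.le_mul_of_pos_right _ (pow_pos (by omega) 2)
      nlinarith [hNN, hL]
    have hm1 := Nat.mul_le_mul_left m
      (show Nat.log 2 ((2 * d) ^ n * D + 1) + 1 ≤ 2 * d * n + Lg + 2 by omega)
    have hm2 := Nat.mul_le_mul_left m hX
    have h4 : 2 ≤ 3 * ((Lg + 1) * N ^ 2) := by nlinarith
    calc H'.card + 1 ≤ H.card + 1 := by omega
      _ ≤ m * (Nat.log 2 ((2 * d) ^ n * D + 1) + 1) + 2 := by omega
      _ ≤ m * (2 * d * n + Lg + 2) + 2 := by omega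
      _ ≤ m * (3 * ((Lg + 1) * N ^ 2)) + 3 * ((Lg + 1) * N ^ 2) := by omega
      _ = 3 * ((m + 1) * (Lg + 1) * N ^ 2) := by ring
  have hW : Nat.log 2 (N * 1 * (2 * d) ^ d) + 2 ≤ 6 * N ^ 2 := by
    refine (log_two_add_two_le N 1 (2 * d) d).trans ?_
    nlinarith
  refine ⟨P, hP0, hPL.trans ?_, hPdeg.trans ?_, hvan⟩
  · calc 20 * (H'.card + 1) * (N * 1 + 1) * (N + 1) * (Nat.log 2 (N * 1 * (2 * d) ^ d) + 2) ^ 2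
        ≤ 20 * (3 * ((m + 1) * (Lg + 1) * N ^ 2)) * (2 * N) * (2 * N) * (6 * N ^ 2) ^ 2 := by
          gcongr <;> omega
      _ = 8640 * (m + 1) * (Lg + 1) * N ^ 8 := by ring
  · calc 10 * (H'.card + 1) * (N * 1 + 1) * (Nat.log 2 (N * 1 * (2 * d) ^ d) + 2) ^ 2
        ≤ 10 * (3 * ((m + 1) * (Lg + 1) * N ^ 2)) * (2 * N) * (6 * N ^ 2) ^ 2 := by
          gcongr; omega
      _ = 2160 * (m + 1) * (Lg + 1) * N ^ 7 := by ring
      _ ≤ 8640 * (m + 1) * (Lg + 1) * N ^ 8 := by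
          have : N ^ 7 ≤ N ^ 8 := Nat.pow_le_pow_right (by omega) (by norm_num)
          gcongr
          omega

/-- **Equations for `𝒟(n,d,s) ∩ {integer coefficients in [-A, A]}` over `ℂ`** (Thm. 1.8's
mechanism at a fixed `n`, coefficient bound as a parameter): from the tree's Δ-free hitting set for
CKRST's `s`-definable slice (`CKRST2020.exists_hittingSet_definableSlice`, v4 Lemma 3.7, on the grid
`{1,…,2s}^n`) and `exists_equation_intBox`. The `VNP` slices embed by
`CKRST2020.vnpSlice_subset_definableSlice` (`SmallDefinableHittingSets.lean`).
[cite: ChatterjeeKumarRamyaSaptharishiTengse2020, Thm. 1.8 (arXiv v4, proof) with the paragraph before Thm. 4.3] -/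
theorem exists_equation_definableSlice_intBox : ∃ e : ℕ, ∀ (n d s A : ℕ), 1 ≤ n → n ≤ s →
    2 ≤ s →
    ∃ (H : Finset (Fin n → ℤ)) (P : MvPolynomial (monomialsDegLE n d) ℂ),
      (∀ a ∈ H, ∀ i, 1 ≤ a i ∧ a i ≤ ((2 * s : ℕ) : ℤ)) ∧
      H.card ≤ s ^ e * (Nat.log 2 ((2 * s) ^ n * s ^ e + 1) + 1) + 1 ∧ P ≠ 0 ∧
      complexity P ≤ 20 * (H.card + 1) * (Nat.card (monomialsDegLE n d) * A + 1) *
          (Nat.card (monomialsDegLE n d) + 1) *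
          (Nat.log 2 (Nat.card (monomialsDegLE n d) * A * (2 * s) ^ d) + 2) ^ 2 ∧
      P.totalDegree ≤ 10 * (H.card + 1) * (Nat.card (monomialsDegLE n d) * A + 1) *
          (Nat.log 2 (Nat.card (monomialsDegLE n d) * A * (2 * s) ^ d) + 2) ^ 2 ∧
      (∀ f : MvPolynomial (Fin n) ℂ, f.totalDegree ≤ d →
        (∀ m, ∃ z : ℤ, coeff m f = (z : ℂ) ∧ |z| ≤ A) →
        (eval (coeffVector (monomialsDegLE n d) f) P = 0 ↔
          (f ≠ 0 → ∃ a ∈ H, eval (fun j => ((a j : ℤ) : ℂ)) f ≠ 0))) ∧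
      (∀ f ∈ definableSlice ℂ n d s, (∀ m, ∃ z : ℤ, coeff m f = (z : ℂ) ∧ |z| ≤ A) →
        eval (coeffVector (monomialsDegLE n d) f) P = 0) := by
  classical
  obtain ⟨e, h37⟩ := exists_hittingSet_definableSlice
  refine ⟨e, fun n d s A hn hns hs => ?_⟩
  set S : Finset ℂ := (Finset.Icc 1 (2 * s)).image (fun k : ℕ => (k : ℂ)) with hS
  have hScard : S.card = 2 * s := by
    rw [hS, Finset.card_image_of_injective _ Nat.cast_injective, Nat.card_Icc]; omega
  obtain ⟨H, hHS, hHcard, hHhit⟩ := h37 n d s hn hns hs S hScard.ge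
  have hHnat : ∀ a ∈ H, ∀ i, ∃ k : ℕ, k ∈ Finset.Icc 1 (2 * s) ∧ (k : ℂ) = a i := by
    intro a ha i
    have := hHS a ha i
    rw [hS, Finset.mem_image] at this
    obtain ⟨k, hk, hka⟩ := this
    exact ⟨k, hk, hka⟩
  obtain ⟨H', hH'card, hH'B, hH'lift⟩ := exists_int_points ℂ (2 * s) H hHnat
  have hB1 : 1 ≤ 2 * s := by omega
  have hH'abs : ∀ a ∈ H', ∀ j, |a j| ≤ ((2 * s : ℕ) : ℤ) := by
    intro a ha j
    obtain ⟨h1, h2⟩ := hH'B a ha j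
    rw [abs_le]; constructor <;> linarith
  obtain ⟨P, hP0, hPL, hPdeg, hPiff⟩ := exists_equation_intBox ℂ n d A (2 * s) hB1 H' hH'abs
  rw [hScard] at hHcard
  refine ⟨H', P, hH'B, hH'card.trans hHcard, hP0, hPL, hPdeg, hPiff, fun f hf hbox => ?_⟩
  refine (hPiff f hf.1 hbox).mpr fun hf0 => ?_
  obtain ⟨a, ha, hne⟩ := hHhit f hf hf0
  obtain ⟨a', ha', rfl⟩ := hH'lift a ha
  exact ⟨a', ha', hne⟩

/-! ### The print's "remark on the largeness" (Siegel-type pigeonhole): non-roots of the equation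
exist among the `{-1,0,1}`-polynomials as soon as `(2NB^d + 1)^{|ℋ|} < 2^N` -/

/-- **Pigeonhole witness (proof of Thm. 1.6, "A remark on the largeness").** Print: "Consider the
map `Γ : ℤ^N → ℤ^{|ℋ|}`, `Γ(z) = (⟨z, eval(a)⟩ : a ∈ ℋ)` … the range of `Γ` restricted to `{0,1}^N`
is `{-M,…,M}^{|ℋ|}`, `M = N · B^d`. Hence, by the pigeon-hole-principle there must be some `b` with
at least `2^N / (2M+1)^{|ℋ|}` pre-images … `h - h_0 ∈ {-1,0,1}^N` … are all coefficient vectors of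
polynomials … with coefficients in `{-1,0,1}` whose coefficient vectors are not zeroes of `P_N`"
("essentially an instance of a lemma of Siegel"). Typed: if `(2·N·B^d + 1)^{|ℋ|} < 2^N` then some
nonzero `g` of degree `≤ d` with coefficients in `{-1,0,1}` vanishes on `ℋ ⊆ [-B,B]^n ∩ ℤ^n`
(so `P(coeff g) ≠ 0` for the equation of `exists_equation_intBox` / `thm_4_3`).
[cite: ChatterjeeKumarRamyaSaptharishiTengse2020, Thm. 1.6 (arXiv v4), proof, "A remark on the largeness"] locator: HOME/lit/src/2004.14147/main.tex L1413–L1430 -/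
theorem exists_signCoeff_vanishing_on (n d B : ℕ) (hB1 : 1 ≤ B) (H : Finset (Fin n → ℤ))
    (hH : ∀ a ∈ H, ∀ j, |a j| ≤ B)
    (hcount : (2 * (Nat.card (monomialsDegLE n d) * B ^ d) + 1) ^ H.card <
      2 ^ Nat.card (monomialsDegLE n d)) :
    ∃ g : MvPolynomial (Fin n) K, g ≠ 0 ∧ g.totalDegree ≤ d ∧ g ∈ signCoeffSlice K n ∧
      ∀ a ∈ H, eval (fun j => ((a j : ℤ) : K)) g = 0 := by
  classical
  haveI : Fintype (monomialsDegLE n d) := (Finsupp.finite_of_degree_le (σ := Fin n) d).fintype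
  rw [Nat.card_eq_fintype_card] at hcount
  set N := Fintype.card (monomialsDegLE n d) with hN
  set M : ℕ := N * B ^ d with hM
  -- `Γ` on `{0,1}^N`, with values in `[-M, M]^ℋ`
  let Γ : (monomialsDegLE n d → Bool) → ({a // a ∈ H} → ℤ) := fun c a =>
    ∑ μ, (if c μ then (1 : ℤ) else 0) * IntEquations.mval (d := d) a.1 μ
  have hΓ : ∀ c ∈ (Finset.univ : Finset (monomialsDegLE n d → Bool)),
      Γ c ∈ Fintype.piFinset fun _ : {a // a ∈ H} => Finset.Icc (-(M : ℤ)) M := by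
    intro c _
    rw [Fintype.mem_piFinset]
    intro a
    rw [Finset.mem_Icc, ← abs_le]
    have h := IntEquations.abs_sum_mul_le (w := fun μ => if c μ then (1 : ℤ) else 0)
      (z := IntEquations.mval (d := d) a.1) (W := 1) (A := B ^ d)
      (fun μ => by split_ifs <;> simp)
      (fun μ => by exact_mod_cast IntEquations.abs_mval_le hB1 (hH a.1 a.2) μ)
    refine h.trans (le_of_eq ?_)
    rw [hM]; push_cast; ring
  have hcard : (Fintype.piFinset fun _ : {a // a ∈ H} => Finset.Icc (-(M : ℤ)) M).card <
      (Finset.univ : Finset (monomialsDegLE n d → Bool)).card := by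
    rw [Fintype.card_piFinset, Finset.prod_const, Finset.card_univ, Finset.card_univ,
      Fintype.card_fun, Fintype.card_bool, Int.card_Icc, Fintype.card_coe]
    have : ((M : ℤ) + 1 - -(M : ℤ)).toNat = 2 * M + 1 := by omega
    rw [this]
    exact hcount
  obtain ⟨c, -, c', -, hne, heq⟩ := Finset.exists_ne_map_eq_of_card_lt_of_maps_to hcard hΓ
  -- the difference vector `z ∈ {-1,0,1}^N`, nonzero
  let z : monomialsDegLE n d → ℤ := fun μ => (if c μ then 1 else 0) - (if c' μ then 1 else 0)
  have hz : ∀ μ, z μ = 0 ∨ z μ = 1 ∨ z μ = -1 := by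
    intro μ; simp only [z]; split_ifs <;> simp
  obtain ⟨μ₀, hμ₀⟩ : ∃ μ₀, c μ₀ ≠ c' μ₀ := by
    by_contra h
    push Not at h
    exact hne (funext h)
  have hz0 : z μ₀ ≠ 0 := by
    simp only [z]
    cases hc : c μ₀ <;> cases hc' : c' μ₀ <;> simp_all
  -- the polynomial `g = Σ_μ z_μ x^μ`
  let g : MvPolynomial (Fin n) K :=
    ∑ μ : monomialsDegLE n d, monomial (μ : Fin n →₀ ℕ) ((z μ : ℤ) : K)
  have hcoeff_in : ∀ μ : monomialsDegLE n d, coeff (μ : Fin n →₀ ℕ) g = ((z μ : ℤ) : K) := by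
    intro μ
    simp only [g, coeff_sum, coeff_monomial]
    rw [Finset.sum_eq_single μ]
    · rw [if_pos rfl]
    · intro ν _ hν
      rw [if_neg]
      exact fun h => hν (Subtype.ext h)
    · intro h; exact absurd (Finset.mem_univ _) h
  have hcoeff_out : ∀ m : Fin n →₀ ℕ, ¬ m.degree ≤ d → coeff m g = 0 := by
    intro m hm
    simp only [g, coeff_sum, coeff_monomial]
    refine Finset.sum_eq_zero fun μ _ => ?_
    rw [if_neg]
    intro h
    exact hm (h ▸ μ.2)
  refine ⟨g, ?_, ?_, ?_, ?_⟩
  · -- `g ≠ 0`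
    intro hg
    have := hcoeff_in μ₀
    rw [hg, coeff_zero] at this
    exact hz0 (by exact_mod_cast this.symm)
  · -- `deg g ≤ d`
    refine totalDegree_finsetSum_le fun μ _ => (totalDegree_monomial_le _ _).trans ?_
    exact μ.2
  · -- coefficients in `{-1,0,1}`
    intro m
    by_cases hm : m.degree ≤ d
    · have h := hcoeff_in ⟨m, hm⟩
      simp only at h
      rcases hz ⟨m, hm⟩ with h0 | h0 | h0
      · exact Or.inl (by rw [h, h0, Int.cast_zero])
      · exact Or.inr (Or.inl (by rw [h, h0, Int.cast_one]))
      · exact Or.inr (Or.inr (by rw [h, h0, Int.cast_neg, Int.cast_one]))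
    · exact Or.inl (hcoeff_out m hm)
  · -- vanishing on `ℋ`
    intro a ha
    have hval : eval (fun j => ((a j : ℤ) : K)) g =
        ((∑ μ, z μ * IntEquations.mval (d := d) a μ : ℤ) : K) := by
      simp only [g, map_sum, eval_monomial]
      push_cast
      refine Finset.sum_congr rfl fun μ _ => ?_
      rw [IntEquations.mval, Finsupp.prod_fintype _ _ (fun _ => pow_zero _)]
      push_cast
      rfl
    have hΓa := congrFun heq ⟨a, ha⟩
    rw [hval, Int.cast_eq_zero]
    have : ∑ μ, z μ * IntEquations.mval (d := d) a μ =
        (∑ μ, (if c μ then (1 : ℤ) else 0) * IntEquations.mval (d := d) a μ) -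
          ∑ μ, (if c' μ then (1 : ℤ) else 0) * IntEquations.mval (d := d) a μ := by
      rw [← Finset.sum_sub_distrib]
      refine Finset.sum_congr rfl fun μ _ => ?_
      simp only [z]; ring
    rw [this, sub_eq_zero]
    exact hΓa

/-- **Thm. 4.3 with the largeness witness: a relative natural proof.** For every class `𝒞` of
degree-`≤ d` polynomials hit by `ℋ ⊆ [-B,B]^n ∩ ℤ^n` with `(2NB^d + 1)^{|ℋ|} < 2^N`, the equation of
`thm_4_3` vanishes on `𝒞 ∩ {-1,0,1}`-coefficients AND is nonzero at the coefficient vector of some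
`{-1,0,1}`-polynomial of degree `≤ d` — the two bullets of Thms. 1.6/1.8 at a fixed `n`, for an
arbitrary class (cf. `IsNaturalProofRel`).
[cite: ChatterjeeKumarRamyaSaptharishiTengse2020, Thm. 4.3 and Thm. 1.6 (arXiv v4), proofs] -/
theorem thm_4_3_withWitness : ∃ c : ℕ, ∀ (n d B : ℕ) (𝒞 : Set (MvPolynomial (Fin n) K))
    (H : Finset (Fin n → ℤ)), 1 ≤ n → 1 ≤ B → (∀ a ∈ H, ∀ j, |a j| ≤ B) →
    (∀ f ∈ 𝒞, f.totalDegree ≤ d) →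
    (∀ f ∈ 𝒞, f ≠ 0 → ∃ a ∈ H, eval (fun j => ((a j : ℤ) : K)) f ≠ 0) →
    (2 * (Nat.card (monomialsDegLE n d) * B ^ d) + 1) ^ H.card <
      2 ^ Nat.card (monomialsDegLE n d) →
    ∃ P : MvPolynomial (monomialsDegLE n d) K, P ≠ 0 ∧
      complexity P ≤ c * B ^ 4 * (H.card + 1) * Nat.card (monomialsDegLE n d) ^ 4 ∧
      P.totalDegree ≤ c * B ^ 4 * (H.card + 1) * Nat.card (monomialsDegLE n d) ^ 4 ∧
      (∀ f ∈ 𝒞, f ∈ signCoeffSlice K n → eval (coeffVector (monomialsDegLE n d) f) P = 0) ∧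
      ∃ h ∈ signCoeffSlice K n, h.totalDegree ≤ d ∧
        eval (coeffVector (monomialsDegLE n d) h) P ≠ 0 := by
  obtain ⟨c, hc⟩ := thm_4_3 K
  refine ⟨c, fun n d B 𝒞 H hn hB1 hH hdeg hhit hcount => ?_⟩
  obtain ⟨P, hP0, hPL, hPdeg, hvan, hlarge⟩ := hc n d B 𝒞 H hn hB1 hH hdeg hhit
  obtain ⟨g, hg0, hgd, hgs, hgv⟩ := exists_signCoeff_vanishing_on K n d B hB1 H hH hcount
  exact ⟨P, hP0, hPL, hPdeg, hvan, g, hgs, hgd, hlarge g hgd hgs hg0 hgv⟩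

end Main


end CKRST2020

end Literature.Barriers.ValiantsHypothesis
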